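import Literature.NumberTheory.LFunctions.HoffsteinSmoothedPerron
import Literature.NumberTheory.LFunctions.ZetaLFunctionProductBounds
import Literature.NumberTheory.LFunctions.SiegelTatuzawaExplicit
import Literature.Analysis.Complex.CahenMellinDirichlet
import Literature.Analysis.SpecialFunctions.InvSqAddSqIntegral
import Literature.NumberTheory.LFunctions.SmoothEulerProductSandwich
import Mathlib.Analysis.Complex.ExponentialBounds
import Mathlib.Analysis.Real.Pi.Bounds
import Mathlib.NumberTheory.ZetaValues
import HarnessLib

/-!
# Hoffstein's Lemma 1 (Acta Arith. 38 (1980), p. 168) — the discharge of `hoffstein1980_lemma1`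

Topic `Literature/NumberTheory/LFunctions`. Everything in this file is PROVED; its last theorem is
`Literature.NumberTheory.LFunctions.hoffstein1980_lemma1_holds : hoffstein1980_lemma1`, discharging
the named fact of `SiegelTatuzawaExplicit.lean` (J. Hoffstein, *On the Siegel–Tatuzawa theorem*,
Acta Arith. **38** (1980) 167–174, Lemma 1: for a fundamental discriminant `|d| > 10⁶`, if
`L(s, χ_d) ≠ 0` on `(β, 1)` and `1 − β < 1/(11.657 log|d|)` then `L(1, χ_d) > 1.507 (1 − β)`; if
`L(s, χ_d) ≠ 0` on `(0, 1)` then `L(1, χ_d) > 1/(1.502 log|d|)`).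

We follow the printed proof (pp. 168–169) step by step, with `F(s) = ζ(s)L(s,χ)` for `ζ_k`
(`Hoffstein1980.zetaL`, file `ZetaLFunctionProductBounds.lean`) and the kernel/weight of
`HoffsteinSmoothedPerron.lean`:

* (3) `hoffstein_contour_identity` — with `I = (1/2πi)∫_{(2−β)} F(s+β) x^s K(s) ds`
  (`K(s) = 1/(s(s+2)⋯(s+6))`), moving the line to `Re s = −3/2 − β` across the simple poles at
  `s = 1 − β, 0, −2`:
  `I = (1/2πi)∫_{(−3/2−β)} … + L(1,χ)x^{1−β}/((1−β)∏_{n=2}^{6}(n+1−β)) + F(β)/6! − F(β−2)x^{−2}/(2·4!)`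
  (tree: `Literature.Analysis.Complex.integral_vertical_sub_eq_sum_of_simplePoles`; the horizontal
  sides vanish by `exists_norm_zetaL_le_pow`);
* (2) `squares_lower_bound` — `I = Σ_{n ≤ x} (1∗χ)(n) n^{-β} P(n/x)/6!` and, keeping the squares
  `n = m²` (`(1∗χ)(m²) ≥ 1`) with `P(u) ≥ 1 − 15u²`:
  `6!·I ≥ Σ_{m ≤ 200} (1/m² − 15 m²/x²)` (the source sums `m ≤ 100` and prints `> 1.635`);
* (1) `integral_norm_hoffG_left_le` — on `Re(s+β) = −3/2`,
  `|∫| ≤ (q² ζ(5/2)²/16π⁴) x^{−3/2−β} R(1−β) π/√(35/4)`, `R(κ) = (5/4)/((5/2 − κ)(1/2 − κ))`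
  (the source: `6!|E| ≤ .250|d|² x^{−5/2}·x^{−(1−β)}`-type bound with `ζ(2)²` for `ζ_k(5/2)`); the
  resulting error constant is `hoffErrConst q κ = 45 q² ζ(5/2)² R(κ)/(2π⁴√(35/4))`, with
  `ζ(5/2) = Z₀(5/2) ≤ 1 + 32^{−1/2} + (2/3)8^{−1/2} ≤ 1.4126` (`bigZ_five_halves_le`);
* the signs `−F(β−2) < 0`, `F(β) ≤ 0` (file `ZetaLFunctionProductBounds.lean`) give the master
  inequality `hoffstein_master`:
  `L(1,χ) ≥ (1−β)·(x^{−(1−β)} Σ_{m≤200}(1/m² − 15m²/x²) − hoffErrConst q (1−β) x^{−5/2})` for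
  `x ≥ 40000`; Hoffstein takes `x = |d|^A`, `A = .92` in the first case and `β = 1 − c₆/log|d|`,
  `c₆ = 1.1`, `A = .87` in the second; we take `A = 14/15`, resp. `c₆ = 1.1`, `A = 13/15` (so that
  `q² x^{−5/2} = q^{−1/3} ≤ 10^{−2}`, resp. `q^{−1/6} ≤ 10^{−1}`), with the certified numerics
  `Σ_{m≤200} 1/m² ≥ 1.6399`, `e^{−(14/15)/11.657} ≥ 0.92305`, `e^{−(13/15)1.1} ≥ 0.3854` in place of
  the printed `1.635`/`1.612`/`.250`; the CONCLUSIONS `1.507 (1 − β)` and `1/(1.502 log|d|)` are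
  exactly the printed ones (`hoffstein_lemma1_part1`, `hoffstein_lemma1_part2`).

## References

* J. Hoffstein, On the Siegel–Tatuzawa theorem, Acta Arith. 38 (1980) 167–174, §2 Lemma 1 and its
  proof, pp. 168–169. [Hoffstein1980SiegelTatuzawa]
-/

noncomputable section

open Complex Set MeasureTheory Filter Topology DirichletCharacter
open scoped Real

namespace Literature.NumberTheory.LFunctions.Hoffstein1980

open Literature.NumberTheory.LFunctions.Booker2006Turing Literature.Analysis.Complex

variable {q : ℕ} [NeZero q]

/-! ### The integrand and the contour identity (3) -/

/-- Hoffstein's integrand `G(s) = ζ_k(s + β) x^s K(s)`, `K(s) = 1/(s(s+2)(s+3)(s+4)(s+5)(s+6))`.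
[cite: Hoffstein1980SiegelTatuzawa, §2 proof of Lemma 1 (3) p. 169] -/
def hoffG (χ : DirichletCharacter ℂ q) (β x : ℝ) (w : ℂ) : ℂ :=
  zetaL χ (w + β) * (x : ℂ) ^ w * hoffKernel w

/-- The kernel without its pole at `0`: `K₀(s) = 1/((s+2)(s+3)(s+4)(s+5)(s+6))`, `K = K₀/s`. [folklore] -/
private def hoffK0 (w : ℂ) : ℂ := 1 / ((w + 2) * (w + 3) * (w + 4) * (w + 5) * (w + 6))

/-- The kernel without its pole at `−2`: `K₂(s) = 1/(s(s+3)(s+4)(s+5)(s+6))`, `K = K₂/(s+2)`. [folklore] -/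
private def hoffK2 (w : ℂ) : ℂ := 1 / (w * (w + 3) * (w + 4) * (w + 5) * (w + 6))

/-- `K = K₀/(w − 0)`. [folklore] -/
private lemma hoffKernel_eq_K0_div {w : ℂ} (h0 : w ≠ 0) : hoffKernel w = hoffK0 w / (w - 0) := by
  unfold hoffKernel hoffK0; rw [sub_zero]; field_simp

/-- `K = K₂/(w − (−2))`. [folklore] -/
private lemma hoffKernel_eq_K2_div {w : ℂ} (h2 : w + 2 ≠ 0) : hoffKernel w = hoffK2 w / (w - (-2)) := by
  unfold hoffKernel hoffK2; rw [sub_neg_eq_add]; field_simp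

/-- Non-vanishing of the linear factors on `Re w > −3`. [folklore] -/
private lemma add_ne_zero_of_re {w : ℂ} {j : ℝ} (h : -j < w.re) : w + j ≠ 0 := by
  intro h'; have := congrArg Complex.re h'; simp at this; linarith

/-- `K₀` is holomorphic on `Re w > −2`. [folklore] -/
private lemma differentiableAt_hoffK0 {w : ℂ} (hw : -2 < w.re) : DifferentiableAt ℂ hoffK0 w := by
  unfold hoffK0
  have h2 := add_ne_zero_of_re (j := 2) (by linarith); have h3 := add_ne_zero_of_re (j := 3) (by linarith)
  have h4 := add_ne_zero_of_re (j := 4) (by linarith); have h5 := add_ne_zero_of_re (j := 5) (by linarith)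
  have h6 := add_ne_zero_of_re (w := w) (j := 6) (by linarith)
  push_cast at h2 h3 h4 h5 h6
  refine (differentiableAt_const _).div (by fun_prop) ?_
  exact mul_ne_zero (mul_ne_zero (mul_ne_zero (mul_ne_zero h2 h3) h4) h5) h6

/-- `K₂` is holomorphic on `−3 < Re w < −1`. [folklore] -/
private lemma differentiableAt_hoffK2 {w : ℂ} (hw : -3 < w.re) (hw' : w.re < -1) :
    DifferentiableAt ℂ hoffK2 w := by
  unfold hoffK2
  have h0 : w ≠ 0 := fun h ↦ by rw [h] at hw'; simp at hw'; linarith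
  have h3 := add_ne_zero_of_re (w := w) (j := 3) (by linarith)
  have h4 := add_ne_zero_of_re (w := w) (j := 4) (by linarith)
  have h5 := add_ne_zero_of_re (w := w) (j := 5) (by linarith)
  have h6 := add_ne_zero_of_re (w := w) (j := 6) (by linarith)
  push_cast at h3 h4 h5 h6
  refine (differentiableAt_const _).div (by fun_prop) ?_
  exact mul_ne_zero (mul_ne_zero (mul_ne_zero (mul_ne_zero h0 h3) h4) h5) h6

/-- `K` is holomorphic off its poles (`Re w > −3`). [folklore] -/
private lemma differentiableAt_hoffKernel {w : ℂ} (hw : -3 < w.re) (h0 : w ≠ 0) (h2 : w + 2 ≠ 0) :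
    DifferentiableAt ℂ hoffKernel w := by
  unfold hoffKernel
  have h3 := add_ne_zero_of_re (w := w) (j := 3) (by linarith)
  have h4 := add_ne_zero_of_re (w := w) (j := 4) (by linarith)
  have h5 := add_ne_zero_of_re (w := w) (j := 5) (by linarith)
  have h6 := add_ne_zero_of_re (w := w) (j := 6) (by linarith)
  push_cast at h3 h4 h5 h6
  refine (differentiableAt_const _).div (by fun_prop) ?_
  exact mul_ne_zero (mul_ne_zero (mul_ne_zero (mul_ne_zero (mul_ne_zero h0 h2) h3) h4) h5) h6

/-- `x^w` is entire for `x > 0`. [folklore] -/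
private lemma differentiable_cpow_const {x : ℝ} (hx : 0 < x) : Differentiable ℂ fun w : ℂ ↦ (x : ℂ) ^ w :=
  differentiable_id.const_cpow (Or.inl (ofReal_ne_zero.2 hx.ne'))

/-! ### The estimate on the left line: Hoffstein's (1) -/

/-- `‖c + iy‖² = c² + y²` for real `c, y`. [folklore] -/
private lemma norm_sq_ofReal_add_mul_I (c y : ℝ) : ‖(c : ℂ) + y * I‖ ^ 2 = c ^ 2 + y ^ 2 := by
  rw [Complex.sq_norm, Complex.normSq_apply]; simp; ring

/-- From `u² ≤ v²` with `v ≥ 0` to `u ≤ v`. [folklore] -/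
private lemma le_of_sq_le_sq' {u v : ℝ} (hv : 0 ≤ v) (h : u ^ 2 ≤ v ^ 2) : u ≤ v := by
  by_contra hlt
  push Not at hlt
  have hu : 0 ≤ u := hv.trans hlt.le
  nlinarith

/-- Hoffstein's factor `R(κ) = (5/2)/(5/2 − κ) · (1/2)/(1/2 − κ)` (`κ = 1 − β`), `= 1` at `β = 1`:
the price of `β < 1` in the bound `J ≤ R(κ) π/√(35/4)` for the integral of (1).
[cite: Hoffstein1980SiegelTatuzawa, §2 proof of Lemma 1 (1) p. 168] -/
def hoffR (κ : ℝ) : ℝ := (5 / 4) / ((5 / 2 - κ) * (1 / 2 - κ))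

/-- `N ≤ P Q` from `N ≤ P²`, `N ≤ Q²` (`N, P, Q ≥ 0`). [folklore] -/
private lemma le_mul_of_le_sq {N P Q : ℝ} (hN : 0 ≤ N) (hP : 0 ≤ P) (hQ : 0 ≤ Q) (h1 : N ≤ P ^ 2)
    (h2 : N ≤ Q ^ 2) : N ≤ P * Q :=
  le_of_sq_le_sq' (mul_nonneg hP hQ) (by rw [mul_pow, sq]; exact mul_le_mul h1 h2 hN (by positivity))

/-- Positivity of `‖c + iy‖` for `c ≠ 0`. [folklore] -/
private lemma norm_line_pos {c : ℝ} (hc : c ≠ 0) (y : ℝ) : 0 < ‖(c : ℂ) + y * I‖ := by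
  refine norm_pos_iff.2 fun h ↦ hc ?_
  have := congrArg Complex.re h; simpa using this

/-- **The pointwise bound behind (1)**: on the line `Re s = a = −5/2 + κ` (`0 ≤ κ < 1/2`),
`(9/4 + y²)(1/4 + y²) ‖K(a + iy)‖ ≤ R(κ)/(35/4 + y²)` — the `Γ`-quotient growth
`|3/2+it|²|1/2+it|²` of `ζ_k(−3/2+it)` against the kernel.
[cite: Hoffstein1980SiegelTatuzawa, §2 proof of Lemma 1 (1) p. 168] -/
theorem left_integrand_bound {κ : ℝ} (hκ0 : 0 ≤ κ) (hκ : κ < 1 / 2) (y : ℝ) :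
    (9 / 4 + y ^ 2) * (1 / 4 + y ^ 2) * ‖hoffKernel (((-5 / 2 + κ : ℝ) : ℂ) + y * I)‖ ≤
      hoffR κ / (35 / 4 + y ^ 2) := by
  -- the six linear factors as `c_j + iy`
  have hwj : ∀ j : ℝ, (((-5 / 2 + κ : ℝ) : ℂ) + y * I) + j = (((-5 / 2 + κ + j) : ℝ) : ℂ) + y * I := by
    intro j; push_cast; ring
  have e0 : (((-5 / 2 + κ : ℝ) : ℂ) + y * I) = (((-5 / 2 + κ + 0) : ℝ) : ℂ) + y * I := by
    push_cast; ring
  unfold hoffKernel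
  rw [norm_div, norm_one]
  simp only [norm_mul]
  rw [show (2 : ℂ) = ((2 : ℝ) : ℂ) by norm_num, show (3 : ℂ) = ((3 : ℝ) : ℂ) by norm_num,
    show (4 : ℂ) = ((4 : ℝ) : ℂ) by norm_num, show (5 : ℂ) = ((5 : ℝ) : ℂ) by norm_num,
    show (6 : ℂ) = ((6 : ℝ) : ℂ) by norm_num, hwj, hwj, hwj, hwj, hwj]
  rw [e0]
  -- abbreviations for the norms
  have hsq : ∀ j : ℝ, ‖(((-5 / 2 + κ + j) : ℝ) : ℂ) + y * I‖ ^ 2 = (-5 / 2 + κ + j) ^ 2 + y ^ 2 :=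
    fun j ↦ norm_sq_ofReal_add_mul_I _ _
  have hp : ∀ j : ℝ, -5 / 2 + κ + j ≠ 0 → 0 < ‖(((-5 / 2 + κ + j) : ℝ) : ℂ) + y * I‖ :=
    fun j hj ↦ norm_line_pos hj y
  have hA := hp 0 (by linarith only [hκ]); have hB2 := hp 2 (by linarith only [hκ])
  have hB3 := hp 3 (by linarith only [hκ0]); have hB4 := hp 4 (by linarith only [hκ0])
  have hB5 := hp 5 (by linarith only [hκ0]); have hB6 := hp 6 (by linarith only [hκ0])
  -- the factors `r₁, r₂`
  have hr₁ : (5 / 2 : ℝ) / (5 / 2 - κ) * (5 / 2 - κ) = 5 / 2 := div_mul_cancel₀ _ (by linarith only [hκ])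
  have hr₂ : (1 / 2 : ℝ) / (1 / 2 - κ) * (1 / 2 - κ) = 1 / 2 := div_mul_cancel₀ _ (by linarith only [hκ])
  have hr₁1 : 1 ≤ (5 / 2 : ℝ) / (5 / 2 - κ) := by rw [le_div_iff₀ (by linarith only [hκ])]; linarith only [hκ0]
  have hr₂1 : 1 ≤ (1 / 2 : ℝ) / (1 / 2 - κ) := by rw [le_div_iff₀ (by linarith only [hκ])]; linarith only [hκ0]
  have hR : hoffR κ = (5 / 2 : ℝ) / (5 / 2 - κ) * ((1 / 2 : ℝ) / (1 / 2 - κ)) := by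
    rw [hoffR, div_mul_div_comm]; norm_num
  -- Claim 1: `9/4 + y² ≤ r₁ ‖c₀+iy‖ ‖c₄+iy‖`
  have h1 : 9 / 4 + y ^ 2 ≤ ((5 / 2 : ℝ) / (5 / 2 - κ) * ‖(((-5 / 2 + κ + 0) : ℝ) : ℂ) + y * I‖) *
      ‖(((-5 / 2 + κ + 4) : ℝ) : ℂ) + y * I‖ := by
    refine le_mul_of_le_sq (by positivity) (by positivity) (norm_nonneg _) ?_ ?_
    · rw [mul_pow, hsq]
      have e : (-5 / 2 + κ + 0) ^ 2 = (5 / 2 - κ) ^ 2 := by ring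
      rw [e, mul_add, ← mul_pow, hr₁]
      have : y ^ 2 ≤ ((5 / 2 : ℝ) / (5 / 2 - κ)) ^ 2 * y ^ 2 := by
        have := one_le_pow₀ (n := 2) hr₁1; nlinarith only [this, sq_nonneg y]
      linarith only [this]
    · rw [hsq]; nlinarith only [hκ0, sq_nonneg y]
  -- Claim 2: `1/4 + y² ≤ r₂ ‖c₂+iy‖ ‖c₃+iy‖`
  have h2 : 1 / 4 + y ^ 2 ≤ ((1 / 2 : ℝ) / (1 / 2 - κ) * ‖(((-5 / 2 + κ + 2) : ℝ) : ℂ) + y * I‖) *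
      ‖(((-5 / 2 + κ + 3) : ℝ) : ℂ) + y * I‖ := by
    refine le_mul_of_le_sq (by positivity) (by positivity) (norm_nonneg _) ?_ ?_
    · rw [mul_pow, hsq]
      have e : (-5 / 2 + κ + 2) ^ 2 = (1 / 2 - κ) ^ 2 := by ring
      rw [e, mul_add, ← mul_pow, hr₂]
      have : y ^ 2 ≤ ((1 / 2 : ℝ) / (1 / 2 - κ)) ^ 2 * y ^ 2 := by
        have := one_le_pow₀ (n := 2) hr₂1; nlinarith only [this, sq_nonneg y]
      linarith only [this]
    · rw [hsq]; nlinarith only [hκ0, sq_nonneg y]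
  -- Claim 3: `35/4 + y² ≤ ‖c₅+iy‖ ‖c₆+iy‖`
  have h3 : 35 / 4 + y ^ 2 ≤ ‖(((-5 / 2 + κ + 5) : ℝ) : ℂ) + y * I‖ *
      ‖(((-5 / 2 + κ + 6) : ℝ) : ℂ) + y * I‖ := by
    refine le_of_sq_le_sq' (by positivity) ?_
    rw [mul_pow, hsq, hsq]
    have h5 : 25 / 4 + y ^ 2 ≤ (-5 / 2 + κ + 5) ^ 2 + y ^ 2 := by nlinarith only [hκ0]
    have h6 : 49 / 4 + y ^ 2 ≤ (-5 / 2 + κ + 6) ^ 2 + y ^ 2 := by nlinarith only [hκ0]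
    calc (35 / 4 + y ^ 2) ^ 2 ≤ (25 / 4 + y ^ 2) * (49 / 4 + y ^ 2) := by nlinarith only [sq_nonneg y]
      _ ≤ ((-5 / 2 + κ + 5) ^ 2 + y ^ 2) * ((-5 / 2 + κ + 6) ^ 2 + y ^ 2) :=
          mul_le_mul h5 h6 (by positivity) (by positivity)
  -- assemble
  set A := ‖(((-5 / 2 + κ + 0) : ℝ) : ℂ) + y * I‖
  set B2 := ‖(((-5 / 2 + κ + 2) : ℝ) : ℂ) + y * I‖
  set B3 := ‖(((-5 / 2 + κ + 3) : ℝ) : ℂ) + y * I‖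
  set B4 := ‖(((-5 / 2 + κ + 4) : ℝ) : ℂ) + y * I‖
  set B5 := ‖(((-5 / 2 + κ + 5) : ℝ) : ℂ) + y * I‖
  set B6 := ‖(((-5 / 2 + κ + 6) : ℝ) : ℂ) + y * I‖
  set r₁ := (5 / 2 : ℝ) / (5 / 2 - κ)
  set r₂ := (1 / 2 : ℝ) / (1 / 2 - κ)
  have hD : 0 < A * B2 * B3 * B4 * B5 * B6 := by positivity
  rw [hR, mul_one_div, div_le_div_iff₀ hD (by positivity)]
  calc (9 / 4 + y ^ 2) * (1 / 4 + y ^ 2) * (35 / 4 + y ^ 2) ≤ (r₁ * A * B4) * (r₂ * B2 * B3) * (B5 * B6) := by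
        gcongr
    _ = r₁ * r₂ * (A * B2 * B3 * B4 * B5 * B6) := by ring

/-! ### The contour identity (3) -/

/-- `‖K(w)‖ ≤ |Im w|^{-6}`: each linear factor has modulus `≥ |Im w|`. [folklore] -/
private lemma norm_hoffKernel_le_of_im {w : ℂ} (hT : 0 < |w.im|) : ‖hoffKernel w‖ ≤ 1 / |w.im| ^ 6 := by
  have hj : ∀ j : ℝ, |w.im| ≤ ‖w + j‖ := fun j ↦ by
    have := abs_im_le_norm (w + j); simpa using this
  have h0 : |w.im| ≤ ‖w‖ := abs_im_le_norm w
  unfold hoffKernel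
  rw [norm_div, norm_one]
  simp only [norm_mul]
  have h2 := hj 2; have h3 := hj 3; have h4 := hj 4; have h5 := hj 5; have h6 := hj 6
  push_cast at h2 h3 h4 h5 h6
  have hprod : |w.im| ^ 6 ≤ ‖w‖ * ‖w + 2‖ * ‖w + 3‖ * ‖w + 4‖ * ‖w + 5‖ * ‖w + 6‖ := by
    calc |w.im| ^ 6 = |w.im| * |w.im| * |w.im| * |w.im| * |w.im| * |w.im| := by ring
      _ ≤ _ := by gcongr
  exact one_div_le_one_div_of_le (by positivity) hprod

/-- `x^σ ≤ x^a + x^b` for `σ ∈ [a, b]`, `x > 0`. [folklore] -/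
private lemma rpow_le_add_of_mem {x a b σ : ℝ} (hx : 0 < x) (h1 : a ≤ σ) (h2 : σ ≤ b) :
    x ^ σ ≤ x ^ a + x ^ b := by
  have hxa : 0 < x ^ a := Real.rpow_pos_of_pos hx a
  have hxb : 0 < x ^ b := Real.rpow_pos_of_pos hx b
  rcases le_or_gt 1 x with hx1 | hx1
  · have := Real.rpow_le_rpow_of_exponent_le hx1 h2; linarith
  · have := Real.rpow_le_rpow_of_exponent_ge hx hx1.le h1; linarith

variable {χ : DirichletCharacter ℂ q}

/-- A primitive character modulo `q > 1` is non-trivial. [folklore] -/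
private lemma ne_one_of_isPrimitive'' (hχ : χ.IsPrimitive) (hq : 1 < q) : χ ≠ 1 := by
  rintro rfl
  have h : (1 : DirichletCharacter ℂ q).conductor = q := hχ
  rw [DirichletCharacter.conductor_one] at h; omega

/-- The integrand is continuous along every vertical line `Re s = c` with `c + β ≠ 1`, `c > −3`,
`c ∉ {0, −2}`. [folklore] -/
private lemma continuous_hoffG_line (hχ1 : χ ≠ 1) {β x c : ℝ} (hx : 0 < x) (hc1 : c + β ≠ 1)
    (hc3 : -3 < c) (hc0 : c ≠ 0) (hc2 : c ≠ -2) :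
    Continuous fun y : ℝ ↦ hoffG χ β x (c + y * I) := by
  refine continuous_iff_continuousAt.2 fun y ↦ ?_
  have hl : Continuous fun y : ℝ ↦ (c : ℂ) + y * I := by fun_prop
  have hwre : ((c : ℂ) + y * I).re = c := by simp
  have hne1 : (c : ℂ) + y * I + β ≠ 1 := fun h ↦ hc1 (by have := congrArg Complex.re h; simpa using this)
  have hne0 : (c : ℂ) + y * I ≠ 0 := fun h ↦ hc0 (by have := congrArg Complex.re h; simpa using this)
  have hne2 : (c : ℂ) + y * I + 2 ≠ 0 := fun h ↦ hc2 (by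
    have := congrArg Complex.re h; simp at this; linarith)
  have hd : DifferentiableAt ℂ (hoffG χ β x) ((c : ℂ) + y * I) := by
    unfold hoffG
    have hlin : DifferentiableAt ℂ (fun w : ℂ ↦ w + β) ((c : ℂ) + y * I) :=
      differentiableAt_id.add (differentiableAt_const _)
    have hz : DifferentiableAt ℂ (zetaL χ ∘ fun w : ℂ ↦ w + β) ((c : ℂ) + y * I) :=
      (differentiableAt_zetaL (s := (c : ℂ) + y * I + β) hχ1 hne1).comp ((c : ℂ) + y * I) hlin
    exact (hz.mul (differentiable_cpow_const hx _)).mul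
      (differentiableAt_hoffKernel (by rw [hwre]; exact hc3) hne0 hne2)
  exact ContinuousAt.comp (g := hoffG χ β x) (f := fun y : ℝ ↦ (c : ℂ) + y * I)
    hd.continuousAt hl.continuousAt

/-- **The left line, pointwise (Hoffstein's (1))**: for `χ` primitive mod `q > 1`, `1/2 < β < 1`,
`x > 0`, on `Re s = −3/2 − β`:
`‖G(s)‖ ≤ (q² ζ(5/2)²/(16π⁴)) · x^{−3/2−β} · R(1−β) · (35/4 + t²)⁻¹`.
[cite: Hoffstein1980SiegelTatuzawa, §2 proof of Lemma 1 (1) p. 168] -/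
theorem norm_hoffG_left_le (hq : 1 < q) (hχ : χ.IsPrimitive) {β : ℝ} (hβ0 : 1 / 2 < β) (hβ1 : β < 1)
    {x : ℝ} (hx : 0 < x) (y : ℝ) :
    ‖hoffG χ β x (↑(-3 / 2 - β) + y * I)‖ ≤
      ((q : ℝ) ^ 2 * bigZ (5 / 2) ^ 2 / (16 * π ^ 4)) * x ^ (-3 / 2 - β) * hoffR (1 - β) *
        (35 / 4 + y ^ 2)⁻¹ := by
  unfold hoffG
  have e1 : ((-3 / 2 - β : ℝ) : ℂ) + y * I + β = -3 / 2 + y * I := by push_cast; ring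
  have e2 : ((-3 / 2 - β : ℝ) : ℂ) + y * I = (((-5 / 2 + (1 - β)) : ℝ) : ℂ) + y * I := by push_cast; ring
  rw [norm_mul, norm_mul, e1, norm_cpow_eq_rpow_re_of_pos hx]
  have hre : (((-3 / 2 - β : ℝ) : ℂ) + y * I).re = -3 / 2 - β := by simp
  rw [hre]
  have hF := norm_zetaL_neg_three_halves_le hq hχ y
  have hK := left_integrand_bound (κ := 1 - β) (by linarith) (by linarith) y
  rw [← e2] at hK
  have hC0 : 0 ≤ (q : ℝ) ^ 2 * bigZ (5 / 2) ^ 2 / (16 * π ^ 4) := by positivity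
  have hxpos : 0 < x ^ (-3 / 2 - β) := Real.rpow_pos_of_pos hx _
  have hP : 0 < (9 / 4 + y ^ 2) * (1 / 4 + y ^ 2) := by positivity
  -- `‖F‖ ≤ C₀ P`, `P ‖K‖ ≤ R/(35/4+y²)`
  calc ‖zetaL χ (-3 / 2 + y * I)‖ * x ^ (-3 / 2 - β) * ‖hoffKernel (↑(-3 / 2 - β) + y * I)‖
      ≤ ((q : ℝ) ^ 2 * ((9 / 4 + y ^ 2) * (1 / 4 + y ^ 2)) * bigZ (5 / 2) ^ 2 / (16 * π ^ 4)) *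
          x ^ (-3 / 2 - β) * ‖hoffKernel (↑(-3 / 2 - β) + y * I)‖ := by gcongr
    _ = ((q : ℝ) ^ 2 * bigZ (5 / 2) ^ 2 / (16 * π ^ 4)) * x ^ (-3 / 2 - β) *
          ((9 / 4 + y ^ 2) * (1 / 4 + y ^ 2) * ‖hoffKernel (↑(-3 / 2 - β) + y * I)‖) := by ring
    _ ≤ ((q : ℝ) ^ 2 * bigZ (5 / 2) ^ 2 / (16 * π ^ 4)) * x ^ (-3 / 2 - β) *
          (hoffR (1 - β) / (35 / 4 + y ^ 2)) := by gcongr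
    _ = _ := by rw [div_eq_mul_inv]; ring

/-- Integrability of `(35/4 + y²)⁻¹` and the value `∫ = π/√(35/4)`. [folklore] -/
private lemma integrable_inv_const_add_sq : Integrable fun y : ℝ ↦ (35 / 4 + y ^ 2)⁻¹ := by
  have h := Literature.Analysis.SpecialFunctions.integrable_inv_sq_add_sq_of_ne_zero
    (a := Real.sqrt (35 / 4)) (by positivity)
  refine h.congr (Eventually.of_forall fun y ↦ ?_)
  simp only [Real.sq_sqrt (show (0:ℝ) ≤ 35 / 4 by norm_num)]

/-- `∫ dy/(35/4 + y²) = π/√(35/4)`. [folklore] -/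
private lemma integral_inv_const_add_sq : ∫ y : ℝ, (35 / 4 + y ^ 2)⁻¹ = π / Real.sqrt (35 / 4) := by
  have h := Literature.Analysis.SpecialFunctions.integral_inv_sq_add_sq_eq_pi_div
    (a := Real.sqrt (35 / 4)) (by positivity)
  rw [Real.sq_sqrt (show (0:ℝ) ≤ 35 / 4 by norm_num)] at h
  exact h

/-- **The left line is absolutely integrable** (Hoffstein's (1)). [cite: Hoffstein1980SiegelTatuzawa, §2 proof of Lemma 1 (1) p. 168] -/
theorem integrable_hoffG_left (hq : 1 < q) (hχ : χ.IsPrimitive) {β : ℝ} (hβ0 : 1 / 2 < β)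
    (hβ1 : β < 1) {x : ℝ} (hx : 0 < x) :
    Integrable fun y : ℝ ↦ hoffG χ β x (↑(-3 / 2 - β) + y * I) := by
  have hχ1 := ne_one_of_isPrimitive'' hχ hq
  refine (integrable_inv_const_add_sq.const_mul (((q : ℝ) ^ 2 * bigZ (5 / 2) ^ 2 / (16 * π ^ 4)) *
    x ^ (-3 / 2 - β) * hoffR (1 - β))).mono' ?_ (Eventually.of_forall (norm_hoffG_left_le hq hχ hβ0 hβ1 hx))
  exact (continuous_hoffG_line hχ1 hx (by linarith) (by linarith) (by linarith) (by linarith)).aestronglyMeasurable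

/-- **Hoffstein's (1)**: `∫ ‖G‖ ≤ (q² ζ(5/2)²/(16π⁴)) x^{−3/2−β} R(1−β) π/√(35/4)` on the left line
(the source: `6!·|(1/2πi)∫| ≤ .250/|d|^{A(3/2+β)−2}`). [cite: Hoffstein1980SiegelTatuzawa, §2 proof of Lemma 1 (1) p. 168] -/
theorem integral_norm_hoffG_left_le (hq : 1 < q) (hχ : χ.IsPrimitive) {β : ℝ} (hβ0 : 1 / 2 < β)
    (hβ1 : β < 1) {x : ℝ} (hx : 0 < x) :
    ∫ y : ℝ, ‖hoffG χ β x (↑(-3 / 2 - β) + y * I)‖ ≤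
      ((q : ℝ) ^ 2 * bigZ (5 / 2) ^ 2 / (16 * π ^ 4)) * x ^ (-3 / 2 - β) * hoffR (1 - β) *
        (π / Real.sqrt (35 / 4)) := by
  rw [← integral_inv_const_add_sq, ← integral_const_mul]
  refine integral_mono_of_nonneg (Eventually.of_forall fun y ↦ norm_nonneg _)
    (integrable_inv_const_add_sq.const_mul _) (Eventually.of_forall (norm_hoffG_left_le hq hχ hβ0 hβ1 hx))



/-- **Hoffstein's contour shift (3), p. 169.** For a primitive `χ` modulo `q > 1`, `1/2 < β < 1` and
`x > 0`: `∫_{Re s = 2−β} G − ∫_{Re s = −3/2−β} G = 2π (Res_{1−β} + Res_0 + Res_{−2})` with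
`Res_{1−β} = L(1,χ) x^{1−β} K(1−β)`, `Res_0 = F(β)/720`, `Res_{−2} = −F(β−2) x^{−2}/48`, i.e.
`I = (1/2πi)∫_{(a)} + L(1,χ)x^{1−β}/((1−β)∏_{n=2}^6(n+1−β)) + ζ_k(β)/6! − ζ_k(−2+β)x^{−2}/(2·4!)`.
[cite: Hoffstein1980SiegelTatuzawa, §2 proof of Lemma 1 (3) p. 169] -/
theorem hoffstein_contour_identity (hq : 1 < q) {χ : DirichletCharacter ℂ q} (hχ : χ.IsPrimitive)
    {β : ℝ} (hβ0 : 1 / 2 < β) (hβ1 : β < 1) {x : ℝ} (hx : 0 < x) :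
    (∫ y : ℝ, hoffG χ β x (↑(2 - β) + y * I)) - ∫ y : ℝ, hoffG χ β x (↑(-3 / 2 - β) + y * I) =
      2 * π * (χ.LFunction 1 * (x : ℂ) ^ ((1 : ℂ) - β) * hoffKernel ((1 : ℂ) - β) +
        zetaL χ β / 720 - zetaL χ (β - 2) * (x : ℂ) ^ (-2 : ℂ) / 48) := by
  have hq1 : q ≠ 1 := by omega
  have hχ1 : χ ≠ 1 := by
    rintro rfl
    have h : (1 : DirichletCharacter ℂ q).conductor = q := hχ
    rw [DirichletCharacter.conductor_one] at h; omega
  set a : ℝ := -3 / 2 - β with ha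
  set b : ℝ := 2 - β with hb
  have hab : a < b := by rw [ha, hb]; linarith
  set p₁ : ℂ := (1 : ℂ) - β with hp₁
  classical
  set S : Finset ℂ := {p₁, 0, -2} with hS
  set r : ℂ → ℂ := fun p ↦ if p = p₁ then χ.LFunction 1 * (x : ℂ) ^ p₁ * hoffKernel p₁
    else if p = 0 then zetaL χ β / 720 else -(zetaL χ (β - 2) * (x : ℂ) ^ (-2 : ℂ) / 48) with hr
  have hp₁re : p₁.re = 1 - β := by simp [hp₁]
  have hp₁0 : p₁ ≠ 0 := fun h ↦ by
    have := congrArg Complex.re h; rw [hp₁re] at this; simp at this; linarith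
  have hp₁2 : p₁ ≠ -2 := fun h ↦ by
    have := congrArg Complex.re h; rw [hp₁re] at this; simp at this; linarith
  have h02 : (0 : ℂ) ≠ -2 := fun h ↦ by have := congrArg Complex.re h; simp at this
  have hsum : ∑ p ∈ S, r p = χ.LFunction 1 * (x : ℂ) ^ p₁ * hoffKernel p₁ +
      zetaL χ β / 720 - zetaL χ (β - 2) * (x : ℂ) ^ (-2 : ℂ) / 48 := by
    rw [hS, Finset.sum_insert (by simp [hp₁0, hp₁2]), Finset.sum_insert (by simp [h02]),
      Finset.sum_singleton]
    simp only [hr, if_neg hp₁0.symm, if_neg hp₁2.symm, if_neg h02.symm, if_true]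
    ring
  set U : Set ℂ := {w : ℂ | -3 < w.re} with hU
  have hUo : IsOpen U := isOpen_lt continuous_const Complex.continuous_re
  have hxw := differentiable_cpow_const hx
  have hmemS : ∀ p : ℂ, p ∈ S ↔ p = p₁ ∨ p = 0 ∨ p = -2 := fun p ↦ by
    rw [hS, Finset.mem_insert, Finset.mem_insert, Finset.mem_singleton]
  -- growth constant for the decay
  obtain ⟨C, hC, hgrowth⟩ := exists_norm_zetaL_le_pow hq hχ
  have key := integral_vertical_sub_eq_sum_of_simplePoles (F := hoffG χ β x) hab S r U hUo
    (fun w hw ↦ by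
      simp only [mem_preimage, mem_Icc] at hw; show -3 < w.re; rw [ha] at hw; linarith)
    (fun p hp ↦ by
      rcases (hmemS p).1 hp with rfl | rfl | rfl
      · rw [hp₁re, ha, hb]; constructor <;> linarith
      · rw [ha, hb]; simp; constructor <;> linarith
      · rw [ha, hb]; simp; constructor <;> linarith)
    ?hF ?hpole ?hia ?hib ?hdecay
  · rw [key, hsum]
  -- (hF) holomorphy off the poles
  · intro w hw
    rcases hw with ⟨hwU, hwS⟩
    have hwU' : -3 < w.re := hwU
    have hwS' : ¬ (w = p₁ ∨ w = 0 ∨ w = -2) := fun h ↦ hwS ((hmemS w).2 h)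
    push Not at hwS'
    obtain ⟨hw1, hw0, hw2⟩ := hwS'
    have hwβ : w + β ≠ 1 := fun h ↦ hw1 (by rw [hp₁]; linear_combination h)
    refine DifferentiableAt.differentiableWithinAt ?_
    unfold hoffG
    have hlin : DifferentiableAt ℂ (fun w : ℂ ↦ w + β) w :=
      differentiableAt_id.add (differentiableAt_const _)
    have hz : DifferentiableAt ℂ (zetaL χ ∘ fun w : ℂ ↦ w + β) w :=
      (differentiableAt_zetaL (s := w + β) hχ1 hwβ).comp w hlin
    exact (hz.mul (hxw w)).mul
      (differentiableAt_hoffKernel hwU' hw0 (fun h ↦ hw2 (by linear_combination h)))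
  -- (hpole) the three simple poles
  · intro p hp
    rcases (hmemS p).1 hp with rfl | rfl | rfl
    · -- `s = 1 − β`: pole of `ζ(s + β)`
      set V : Set ℂ := {w : ℂ | w ≠ 0 ∧ -2 < w.re} with hV
      refine ⟨fun w ↦ zetaReg1 (w + β) * χ.LFunction (w + β) * (x : ℂ) ^ w * hoffKernel w, V,
        ?_, ?_, ?_, ?_⟩
      · exact (isOpen_ne.inter (isOpen_lt continuous_const Complex.continuous_re)).mem_nhds
          ⟨hp₁0, by show -2 < p₁.re; rw [hp₁re]; linarith⟩
      · intro w hw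
        rcases hw with ⟨hw0, hw2⟩
        refine DifferentiableAt.differentiableWithinAt ?_
        have hlin : DifferentiableAt ℂ (fun w : ℂ ↦ w + β) w :=
          differentiableAt_id.add (differentiableAt_const _)
        have hz : DifferentiableAt ℂ (fun w : ℂ ↦ zetaReg1 (w + β)) w :=
          (differentiable_zetaReg1 _).comp w hlin
        have hL : DifferentiableAt ℂ (fun w : ℂ ↦ χ.LFunction (w + β)) w :=
          (differentiable_LFunction hχ1 _).comp w hlin
        exact ((hz.mul hL).mul (hxw w)).mul
          (differentiableAt_hoffKernel (by linarith) hw0 (add_ne_zero_of_re (j := 2) (by linarith)))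
      · simp only [hr, if_pos rfl]
        rw [show p₁ + β = 1 by rw [hp₁]; ring, zetaReg1_mul_LFunction_one]
      · intro w _ hwp
        have hwβ : w + β ≠ 1 := fun h ↦ hwp (by rw [hp₁]; linear_combination h)
        unfold hoffG
        rw [zetaL_eq_div_of_ne_one χ hwβ, show w + ↑β - 1 = w - p₁ by rw [hp₁]; ring]
        field_simp
    · -- `s = 0`: pole of the kernel
      set V : Set ℂ := {w : ℂ | w ≠ p₁ ∧ -2 < w.re} with hV
      refine ⟨fun w ↦ zetaL χ (w + β) * (x : ℂ) ^ w * hoffK0 w, V, ?_, ?_, ?_, ?_⟩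
      · exact (isOpen_ne.inter (isOpen_lt continuous_const Complex.continuous_re)).mem_nhds
          ⟨hp₁0.symm, by show -2 < (0:ℂ).re; simp⟩
      · intro w hw
        rcases hw with ⟨hw1, hw2⟩
        have hwβ : w + β ≠ 1 := fun h ↦ hw1 (by rw [hp₁]; linear_combination h)
        refine DifferentiableAt.differentiableWithinAt ?_
        have hlin : DifferentiableAt ℂ (fun w : ℂ ↦ w + β) w :=
          differentiableAt_id.add (differentiableAt_const _)
        have hz : DifferentiableAt ℂ (zetaL χ ∘ fun w : ℂ ↦ w + β) w :=
          (differentiableAt_zetaL (s := w + β) hχ1 hwβ).comp w hlin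
        exact (hz.mul (hxw w)).mul (differentiableAt_hoffK0 hw2)
      · simp only [hr, if_neg hp₁0.symm, if_true]
        rw [zero_add, cpow_zero, mul_one]
        unfold hoffK0; ring
      · intro w _ hw0
        unfold hoffG
        rw [hoffKernel_eq_K0_div hw0]
        field_simp
    · -- `s = −2`: pole of the kernel
      set V : Set ℂ := {w : ℂ | -3 < w.re ∧ w.re < -1} with hV
      refine ⟨fun w ↦ zetaL χ (w + β) * (x : ℂ) ^ w * hoffK2 w, V, ?_, ?_, ?_, ?_⟩
      · exact ((isOpen_lt continuous_const Complex.continuous_re).inter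
          (isOpen_lt Complex.continuous_re continuous_const)).mem_nhds (by simp; norm_num)
      · intro w hw
        rcases hw with ⟨hw3, hw1⟩
        have hwβ : w + β ≠ 1 := fun h ↦ by
          have := congrArg Complex.re h; simp at this; linarith
        refine DifferentiableAt.differentiableWithinAt ?_
        have hlin : DifferentiableAt ℂ (fun w : ℂ ↦ w + β) w :=
          differentiableAt_id.add (differentiableAt_const _)
        have hz : DifferentiableAt ℂ (zetaL χ ∘ fun w : ℂ ↦ w + β) w :=
          (differentiableAt_zetaL (s := w + β) hχ1 hwβ).comp w hlin
        exact (hz.mul (hxw w)).mul (differentiableAt_hoffK2 hw3 hw1)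
      · simp only [hr, if_neg hp₁2.symm, if_neg h02.symm]
        rw [show (-2 : ℂ) + β = (β : ℂ) - 2 by ring]
        unfold hoffK2; ring
      · intro w _ hw2
        unfold hoffG
        have h2 : w + 2 ≠ 0 := fun h ↦ hw2 (by linear_combination h)
        rw [hoffKernel_eq_K2_div h2]
        field_simp
  -- (hia) integrability on the left line
  · exact integrable_hoffG_left hq hχ hβ0 hβ1 hx
  -- (hib) integrability on the right line
  · have hb0 : 0 < b := by rw [hb]; linarith
    have hK := integrable_hoffKernel_vertical hb0
    have hcont : Continuous fun y : ℝ ↦ zetaL χ (↑b + y * I + β) * (x : ℂ) ^ ((b : ℂ) + y * I) := by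
      refine Continuous.mul ?_ ((differentiable_cpow_const hx).continuous.comp (by fun_prop))
      refine continuous_iff_continuousAt.2 fun y ↦ ?_
      have hne : (b : ℂ) + y * I + β ≠ 1 := by
        intro h
        have h' := congrArg Complex.re h
        simp only [add_re, ofReal_re, mul_re, I_re, I_im, ofReal_im, mul_zero, zero_mul, sub_zero,
          one_re] at h'
        rw [hb] at h'; linarith
      exact ContinuousAt.comp (g := zetaL χ) (f := fun y : ℝ ↦ (b : ℂ) + y * I + β)
        (differentiableAt_zetaL hχ1 hne).continuousAt
        (by fun_prop : Continuous fun y : ℝ ↦ (b : ℂ) + y * I + β).continuousAt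
    have hZ2 : 0 ≤ bigZ 2 := (bigZ_pos (by norm_num)).le
    have hint := hK.bdd_mul hcont.aestronglyMeasurable (c := bigZ 2 * bigZ 2 * x ^ b)
      (Eventually.of_forall fun y ↦ by
        rw [norm_mul, norm_cpow_eq_rpow_re_of_pos hx]
        have hre : ((b : ℂ) + y * I).re = b := by simp
        rw [hre]
        have e : (b : ℂ) + y * I + β = ((2 : ℝ) : ℂ) + y * I := by rw [hb]; push_cast; ring
        rw [e, zetaL, norm_mul]
        have h1 := norm_riemannZeta_le_bigZ (σ := 2) (by norm_num) y
        have h2 := norm_LFunction_le_bigZ χ (σ := 2) (by norm_num) y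
        have hxb : 0 ≤ x ^ b := (Real.rpow_pos_of_pos hx b).le
        calc ‖riemannZeta (↑(2:ℝ) + y * I)‖ * ‖χ.LFunction (↑(2:ℝ) + y * I)‖ * x ^ b
            ≤ bigZ 2 * bigZ 2 * x ^ b := by gcongr)
    exact hint
  -- (hdecay) the horizontal sides
  · intro ε hε
    set M : ℝ := x ^ a + x ^ b with hM
    have hM0 : 0 < M := by rw [hM]; exact add_pos (Real.rpow_pos_of_pos hx a) (Real.rpow_pos_of_pos hx b)
    refine ⟨max 2 (C * M / ε), fun T hT σ hσ ↦ ?_⟩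
    have hT2 : 2 ≤ |T| := (le_max_left _ _).trans hT
    have hT1 : C * M / ε ≤ |T| := (le_max_right _ _).trans hT
    have hTpos : 0 < |T| := by linarith
    set w : ℂ := (σ : ℂ) + T * I with hw
    have hwre : w.re = σ := by simp [hw]
    have hwim : w.im = T := by simp [hw]
    have hz : ‖zetaL χ (w + β)‖ ≤ C * T ^ 4 := by
      have := hgrowth (w + β) (by simp [hw]; rw [ha] at hσ; linarith [hσ.1])
        (by simp [hw]; rw [hb] at hσ; linarith [hσ.2]) (by simpa [hw] using hT2)
      simpa [hw] using this
    have hxσ : ‖(x : ℂ) ^ w‖ ≤ M := by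
      rw [norm_cpow_eq_rpow_re_of_pos hx, hwre]; exact rpow_le_add_of_mem hx hσ.1 hσ.2
    have hKn : ‖hoffKernel w‖ ≤ 1 / |T| ^ 6 := by
      have := norm_hoffKernel_le_of_im (w := w) (by rw [hwim]; exact hTpos); rwa [hwim] at this
    have hT4 : T ^ 4 = |T| ^ 4 := (Even.pow_abs (by norm_num : Even 4) T).symm
    have hTT : |T| ≤ |T| ^ 2 := by nlinarith
    calc ‖hoffG χ β x w‖ = ‖zetaL χ (w + β)‖ * ‖(x : ℂ) ^ w‖ * ‖hoffKernel w‖ := by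
          unfold hoffG; rw [norm_mul, norm_mul]
      _ ≤ (C * T ^ 4) * M * (1 / |T| ^ 6) := by gcongr
      _ = C * M / |T| ^ 2 := by rw [hT4]; field_simp
      _ ≤ C * M / |T| := div_le_div_of_nonneg_left (by positivity) hTpos hTT
      _ ≤ ε := by rw [div_le_iff₀ hTpos]; rw [div_le_iff₀ hε] at hT1; linarith

/-! ### The right line is the smoothed sum (p. 169, "it follows that `I = Σ …`") -/

/-- **`I = Σ_{N𝔞 ≤ x} (N𝔞)^{-β} (1/6! − Σ …)`** in our notation: on `Re s = 2 − β` the integral of `G`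
is `2π Σ_n (1∗χ)(n) n^{-β} w(n/x)` (the smoothed Perron formula of `HoffsteinSmoothedPerron.lean`
applied to `F = Σ (1∗χ)(n) n^{-s}`). [cite: Hoffstein1980SiegelTatuzawa, §2 proof of Lemma 1 p. 169] -/
theorem integral_hoffG_right_eq (χ : DirichletCharacter ℂ q) {β : ℝ} (hβ1 : β < 1) {x : ℝ}
    (hx : 0 < x) :
    ∫ y : ℝ, hoffG χ β x (↑(2 - β) + y * I) =
      2 * π * ∑' n : ℕ, LSeries.term (fun n ↦ χ.zetaMul n) β n * hoffWeight ((n : ℝ) / x) := by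
  have hc : 0 < 2 - β := by linarith
  have hre : 1 < ((β : ℂ) + ((2 - β : ℝ) : ℂ)).re := by simp only [add_re, ofReal_re]; linarith
  have hsum := summable_norm_term_zetaMul χ hre
  have h := integral_LSeries_mul_hoffKernel_eq (fun n ↦ χ.zetaMul n) (s := (β : ℂ)) hc hsum hx
  rw [← h]
  refine integral_congr_ae (Eventually.of_forall fun y ↦ ?_)
  simp only [hoffG]
  have e : ((2 - β : ℝ) : ℂ) + y * I + β = (β : ℂ) + ((2 - β : ℝ) : ℂ) + y * I := by ring
  have hre' : 1 < ((β : ℂ) + ((2 - β : ℝ) : ℂ) + y * I).re := by simp only [add_re, ofReal_re, mul_re, I_re, I_im, ofReal_im, mul_zero, zero_mul, sub_zero]; linarith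
  rw [e, zetaL_eq_LSeries χ hre']

/-! ### The squares lower bound (2), p. 169 -/

open Literature.NumberTheory.LFunctions.SmoothEulerProduct in
/-- `∑_{i < 2n+1} (−1)^i = 1`. [folklore] -/
private theorem sum_range_neg_one_pow_odd (n : ℕ) : ∑ i ∈ Finset.range (2 * n + 1), (-1 : ℝ) ^ i = 1 := by
  induction n with
  | zero => simp
  | succ n ih =>
    rw [show 2 * (n + 1) + 1 = 2 * n + 1 + 1 + 1 by ring, Finset.sum_range_succ,
      Finset.sum_range_succ, ih, Odd.neg_one_pow ⟨n, by ring⟩, Even.neg_one_pow ⟨n + 1, by ring⟩]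
    norm_num

omit [NeZero q] in
open Literature.NumberTheory.LFunctions.SmoothEulerProduct in
/-- **"`n²` is the norm of an ideal for every integer `n`"**: `(1∗χ)(m²) ≥ 1` for a quadratic `χ`
and `m ≥ 1` (at `p^{2k}` the local factor `Σ_{i ≤ 2k} χ(p)^i` is `2k+1`, `1` or `1`).
[cite: Hoffstein1980SiegelTatuzawa, §2 proof of Lemma 1 p. 169] -/
theorem one_le_zetaMul_sq_re (hq2 : χ ^ 2 = 1) {m : ℕ} (hm : 1 ≤ m) : 1 ≤ (χ.zetaMul (m ^ 2)).re := by
  induction m using Nat.recOnPrimeCoprime with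
  | zero => omega
  | prime_pow p k hp =>
    rw [← pow_mul, zetaMul_prime_pow_re χ hq2 hp]
    rcases apply_re_trichotomy χ hq2 p with h | h | h <;> rw [h]
    · rw [Finset.sum_range_succ']
      simp
    · simp
    · rw [show k * 2 + 1 = 2 * k + 1 by ring, sum_range_neg_one_pow_odd]
  | coprime a b ha hb hab iha ihb =>
    rw [mul_pow, zetaMul_re_mul χ hq2 (hab.pow 2 2)]
    have h1 := iha (by omega)
    have h2 := ihb (by omega)
    nlinarith

omit [NeZero q] in
open Literature.NumberTheory.LFunctions.SmoothEulerProduct in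
/-- The real part of one term of the smoothed sum: for `n ≥ 1`,
`Re((1∗χ)(n) n^{-β} w(n/x)) = (1∗χ)(n) · n^{-β} · w(n/x)` (all three real, the first and last `≥ 0`).
[cite: Hoffstein1980SiegelTatuzawa, §2 proof of Lemma 1 p. 169] -/
theorem re_term_mul_hoffWeight (hq2 : χ ^ 2 = 1) (β : ℝ) {n : ℕ} (hn : n ≠ 0) (u : ℝ) :
    (LSeries.term (fun n ↦ χ.zetaMul n) β n * hoffWeight u).re =
      (χ.zetaMul n).re * (n : ℝ) ^ (-β) * (hoffWeight u).re := by
  have hn0 : (0 : ℝ) ≤ n := Nat.cast_nonneg n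
  rw [LSeries.term_of_ne_zero hn]
  have hpow : (n : ℂ) ^ (β : ℂ) = (((n : ℝ) ^ β : ℝ) : ℂ) := by
    rw [Complex.ofReal_cpow hn0, ofReal_natCast]
  have hval : (fun n ↦ χ.zetaMul n) n / (n : ℂ) ^ (β : ℂ) =
      ((((χ.zetaMul n).re * (n : ℝ) ^ (-β) : ℝ)) : ℂ) := by
    have hz : χ.zetaMul n = (((χ.zetaMul n).re : ℝ) : ℂ) := by
      apply Complex.ext
      · simp
      · simp [Literature.NumberTheory.LFunctions.ZetaMul.zetaMul_im_eq_zero χ hq2 n]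
    rw [div_eq_mul_inv]
    show χ.zetaMul n * ((n : ℂ) ^ (β : ℂ))⁻¹ = _
    rw [hpow, Real.rpow_neg hn0]
    conv_lhs => rw [hz]
    push_cast
    ring
  rw [hval, mul_re, ofReal_re, ofReal_im, hoffWeight_im, zero_mul, sub_zero]

omit [NeZero q] in
open Literature.NumberTheory.LFunctions.SmoothEulerProduct in
/-- **Hoffstein's (2)**: for a quadratic `χ`, `β ≤ 1` and `x ≥ 40000`,
`Σ_{m ≤ 200} (1/m² − 15 m²/x²) ≤ 6!·I = 720 · Re Σ_n (1∗χ)(n) n^{-β} w(n/x)`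
(every term is `≥ 0`; keep the squares `n = m²`, `(1∗χ)(m²) ≥ 1`, `m^{-2β} ≥ m^{-2}`,
`P(u) ≥ 1 − 15u²`). The source keeps `m ≤ 100` and prints the value `> 1.635`.
[cite: Hoffstein1980SiegelTatuzawa, §2 proof of Lemma 1 (2) p. 169] -/
theorem squares_lower_bound (hq2 : χ ^ 2 = 1) {β : ℝ} (hβ1 : β ≤ 1) {x : ℝ} (hx : 40000 ≤ x) :
    ∑ m ∈ Finset.range 200, (1 / ((m : ℝ) + 1) ^ 2 - 15 * ((m : ℝ) + 1) ^ 2 / x ^ 2) ≤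
      720 * (∑' n : ℕ, LSeries.term (fun n ↦ χ.zetaMul n) β n * hoffWeight ((n : ℝ) / x)).re := by
  have hx0 : 0 < x := by linarith
  set f : ℕ → ℂ := fun n ↦ LSeries.term (fun n ↦ χ.zetaMul n) β n * hoffWeight ((n : ℝ) / x) with hf
  set N : ℕ := ⌊x⌋₊ with hN
  have hxN : x < N + 1 := Nat.lt_floor_add_one x
  rw [tsum_term_mul_hoffWeight_eq_sum _ _ hx0 N hxN, Complex.re_sum]
  -- nonnegativity of every term
  have hnonneg : ∀ n ∈ Finset.range (N + 1), 0 ≤ (f n).re := by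
    intro n _
    rcases eq_or_ne n 0 with rfl | hn
    · simp [hf]
    · rw [hf]
      simp only
      rw [re_term_mul_hoffWeight hq2 β hn]
      exact mul_nonneg (mul_nonneg (zetaMul_re_nonneg χ hq2 n) (Real.rpow_nonneg (Nat.cast_nonneg n) _))
        (hoffWeight_re_nonneg (by positivity))
  -- the squares `(m+1)²`, `m < 200`, are among `n ≤ N`
  set g : ℕ → ℕ := fun m ↦ (m + 1) ^ 2 with hg
  have hginj : Set.InjOn g (Finset.range 200 : Set ℕ) := by
    intro a _ b _ h
    simp only [hg] at h
    have := Nat.pow_left_injective (by norm_num : 2 ≠ 0) h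
    omega
  have hsub : Finset.image g (Finset.range 200) ⊆ Finset.range (N + 1) := by
    intro n hn
    rw [Finset.mem_image] at hn
    obtain ⟨m, hm, rfl⟩ := hn
    rw [Finset.mem_range] at hm ⊢
    have hm' : (m + 1) ^ 2 ≤ 40000 :=
      (Nat.pow_le_pow_left (Nat.succ_le_of_lt hm) 2).trans (by norm_num)
    have h' : (((m + 1) ^ 2 : ℕ) : ℝ) < ((N + 1 : ℕ) : ℝ) := by
      calc (((m + 1) ^ 2 : ℕ) : ℝ) ≤ 40000 := by exact_mod_cast hm'
        _ ≤ x := hx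
        _ < N + 1 := hxN
        _ = ((N + 1 : ℕ) : ℝ) := by push_cast; ring
    show (m + 1) ^ 2 < N + 1
    exact Nat.cast_lt.1 h'
  have hle : ∑ n ∈ Finset.image g (Finset.range 200), (f n).re ≤ ∑ n ∈ Finset.range (N + 1), (f n).re :=
    Finset.sum_le_sum_of_subset_of_nonneg hsub fun n hn _ ↦ hnonneg n hn
  rw [Finset.sum_image hginj] at hle
  -- each square contributes at least `(1/(m+1)² − 15(m+1)²/x²)/720`
  have hterm : ∀ m ∈ Finset.range 200,
      (1 / ((m : ℝ) + 1) ^ 2 - 15 * ((m : ℝ) + 1) ^ 2 / x ^ 2) / 720 ≤ (f (g m)).re := by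
    intro m hm
    rw [Finset.mem_range] at hm
    have hm1 : (1 : ℝ) ≤ (m : ℝ) + 1 := by linarith [(m.cast_nonneg : (0:ℝ) ≤ m)]
    have hn0 : g m ≠ 0 := by simp [hg]
    have hncast : ((g m : ℕ) : ℝ) = ((m : ℝ) + 1) ^ 2 := by simp [hg]
    rw [hf]
    simp only
    rw [re_term_mul_hoffWeight hq2 β hn0, hncast]
    set u : ℝ := ((m : ℝ) + 1) ^ 2 / x with hu
    have hu0 : 0 ≤ u := by positivity
    have hu1 : u ≤ 1 := by
      rw [hu, div_le_one hx0]
      have : ((m : ℝ) + 1) ^ 2 ≤ 40000 := by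
        have : (m : ℝ) + 1 ≤ 200 := by exact_mod_cast hm
        nlinarith
      linarith
    have hw : (1 - 15 * u ^ 2) / 720 ≤ (hoffWeight u).re := by
      rw [hoffWeight_of_le_one hu1, ofReal_re]
      exact div_le_div_of_nonneg_right (one_sub_le_hoffPoly hu0 hu1) (by norm_num)
    have hw0 : 0 ≤ (hoffWeight u).re := hoffWeight_re_nonneg hu0
    have hsq1 : (1 : ℝ) ≤ ((m : ℝ) + 1) ^ 2 := by nlinarith
    have hpow : 1 / ((m : ℝ) + 1) ^ 2 ≤ (((m : ℝ) + 1) ^ 2) ^ (-β) := by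
      rw [one_div, ← Real.rpow_neg_one]
      exact Real.rpow_le_rpow_of_exponent_le hsq1 (by linarith)
    have hpow0 : 0 ≤ (((m : ℝ) + 1) ^ 2) ^ (-β) := Real.rpow_nonneg (by positivity) _
    have hz := one_le_zetaMul_sq_re (χ := χ) hq2 (m := m + 1) (by omega)
    have hzcast : (χ.zetaMul (g m)).re = (χ.zetaMul ((m + 1) ^ 2)).re := by rw [hg]
    rw [hzcast]
    have e : (1 / ((m : ℝ) + 1) ^ 2 - 15 * ((m : ℝ) + 1) ^ 2 / x ^ 2) / 720 =
        (1 / ((m : ℝ) + 1) ^ 2) * ((1 - 15 * u ^ 2) / 720) := by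
      rw [hu]; field_simp
    rw [e]
    calc 1 / ((m : ℝ) + 1) ^ 2 * ((1 - 15 * u ^ 2) / 720)
        ≤ 1 / ((m : ℝ) + 1) ^ 2 * (hoffWeight u).re := by gcongr
      _ ≤ (((m : ℝ) + 1) ^ 2) ^ (-β) * (hoffWeight u).re := by gcongr
      _ = 1 * ((((m : ℝ) + 1) ^ 2) ^ (-β) * (hoffWeight u).re) := by ring
      _ ≤ (χ.zetaMul ((m + 1) ^ 2)).re * ((((m : ℝ) + 1) ^ 2) ^ (-β) * (hoffWeight u).re) :=
          mul_le_mul_of_nonneg_right hz (mul_nonneg hpow0 hw0)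
      _ = _ := by ring
  have hsum := Finset.sum_le_sum hterm
  rw [← Finset.sum_div, div_le_iff₀ (by norm_num : (0:ℝ) < 720)] at hsum
  linarith

/-! ### Assembly: `L(1,χ)/(1−β) > (6! I − 6!|E|)/x^{1−β}` (p. 169) -/

/-- The error constant `C_E(q, κ) = 45 q² ζ(5/2)² R(κ)/(2π⁴ √(35/4))`, i.e. `6!/(2π)` times the
constant of `integral_norm_hoffG_left_le`; the final error is `C_E x^{−5/2}` (Hoffstein: `.250 |d|²`
in place of `C_E`, with `x = |d|^A`). [cite: Hoffstein1980SiegelTatuzawa, §2 proof of Lemma 1 (1) p. 168] -/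
def hoffErrConst (q : ℕ) (κ : ℝ) : ℝ :=
  45 * (q : ℝ) ^ 2 * bigZ (5 / 2) ^ 2 * hoffR κ / (2 * π ^ 4 * Real.sqrt (35 / 4))

open Literature.NumberTheory.LFunctions.DirichletAbel in
/-- **Hoffstein's master inequality** ((1), (2), (3) and the signs, p. 169): for a real primitive
`χ` modulo `q > 1`, `1/2 < β < 1` with `L(β, χ) ≥ 0` (e.g. a real zero, or no zero on `[β, 1]`), and
`x ≥ 40000`,
`L(1, χ) ≥ (1 − β) · ( x^{−(1−β)} Σ_{m ≤ 200}(1/m² − 15m²/x²) − C_E(q, 1−β) x^{−5/2} )`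
— the formal version of "`L(1,χ)/(1−β) > 1.612/e^{Ac} − .250/(10⁶)^{(5/2)A−2}`".
[cite: Hoffstein1980SiegelTatuzawa, §2 proof of Lemma 1 p. 169] -/
theorem hoffstein_master (hq : 1 < q) (hχ : χ.IsPrimitive) (hquad : χ.IsQuadratic) {β : ℝ}
    (hβ0 : 1 / 2 < β) (hβ1 : β < 1) (hLβ : 0 ≤ (χ.LFunction β).re) {x : ℝ} (hx : 40000 ≤ x) :
    (1 - β) * (x ^ (-(1 - β)) * ∑ m ∈ Finset.range 200, (1 / ((m : ℝ) + 1) ^ 2 - 15 * ((m : ℝ) + 1) ^ 2 / x ^ 2)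
      - hoffErrConst q (1 - β) * x ^ (-(5 / 2 : ℝ))) ≤ (χ.LFunction 1).re := by
  have hx0 : 0 < x := by linarith
  have hχ1 := ne_one_of_isPrimitive'' hχ hq
  have hq2 : χ ^ 2 = 1 := hquad.sq_eq_one
  have hκ : 0 < 1 - β := by linarith
  -- the identity (3) and the Perron formula
  have hId := hoffstein_contour_identity hq hχ hβ0 hβ1 hx0
  rw [integral_hoffG_right_eq χ hβ1 hx0] at hId
  set S : ℂ := ∑' n : ℕ, LSeries.term (fun n ↦ χ.zetaMul n) β n * hoffWeight ((n : ℝ) / x) with hS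
  set Il : ℂ := ∫ y : ℝ, hoffG χ β x (↑(-3 / 2 - β) + y * I) with hIl
  -- the residue at `1 − β` is real: `L(1,χ) x^{1−β} k`
  set k : ℝ := 1 / ((1 - β) * (3 - β) * (4 - β) * (5 - β) * (6 - β) * (7 - β)) with hk
  have hk0 : 0 < k := by rw [hk]; apply one_div_pos.2; apply mul_pos (mul_pos (mul_pos (mul_pos (mul_pos hκ _) _) _) _) <;> linarith
  have hKp : hoffKernel ((1 : ℂ) - β) = (k : ℂ) := by
    unfold hoffKernel; rw [hk]; push_cast; ring_nf
  have hxp : (x : ℂ) ^ ((1 : ℂ) - β) = ((x ^ (1 - β) : ℝ) : ℂ) := by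
    rw [show (1 : ℂ) - β = ((1 - β : ℝ) : ℂ) by push_cast; ring, Complex.ofReal_cpow hx0.le]
  have hx2 : (x : ℂ) ^ (-2 : ℂ) = ((x ^ (-2 : ℝ) : ℝ) : ℂ) := by
    rw [show (-2 : ℂ) = ((-2 : ℝ) : ℂ) by norm_num, Complex.ofReal_cpow hx0.le]
  have hRes1 : (χ.LFunction 1 * (x : ℂ) ^ ((1 : ℂ) - β) * hoffKernel ((1 : ℂ) - β)).re =
      (χ.LFunction 1).re * (x ^ (1 - β) * k) := by
    rw [hKp, hxp, mul_assoc, ← ofReal_mul, Complex.re_mul_ofReal]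
  -- signs of the other two residues
  have hRes0 : (zetaL χ β / 720).re ≤ 0 := by
    have h := (zetaL_ofReal_re_nonpos hχ1 hq2 (by linarith) hβ1 hLβ).1
    rw [show (720 : ℂ) = ((720 : ℝ) : ℂ) by norm_num, Complex.div_ofReal_re]
    exact div_nonpos_of_nonpos_of_nonneg h (by norm_num)
  have hRes2 : 0 ≤ (zetaL χ (β - 2) * (x : ℂ) ^ (-2 : ℂ) / 48).re := by
    have h := (zetaL_ofReal_pos_of_mem_Ioo hq hχ hquad (σ := β - 2) (by linarith) (by linarith)).1
    rw [hx2, show (48 : ℂ) = ((48 : ℝ) : ℂ) by norm_num, Complex.div_ofReal_re,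
      show ((β : ℂ) - 2) = ((β - 2 : ℝ) : ℂ) by push_cast; ring, Complex.re_mul_ofReal]
    exact div_nonneg (mul_nonneg h.le (Real.rpow_pos_of_pos hx0 _).le) (by norm_num)
  -- the left integral
  have hIl : Il.re ≤ ((q : ℝ) ^ 2 * bigZ (5 / 2) ^ 2 / (16 * π ^ 4)) * x ^ (-3 / 2 - β) * hoffR (1 - β) *
      (π / Real.sqrt (35 / 4)) := by
    refine (Complex.re_le_norm _).trans ((norm_integral_le_integral_norm _).trans ?_)
    exact integral_norm_hoffG_left_le hq hχ hβ0 hβ1 hx0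
  -- real part of the identity
  have hre := congrArg Complex.re hId
  rw [show (2 : ℂ) * π = ((2 * π : ℝ) : ℂ) by push_cast; ring] at hre
  simp only [Complex.sub_re, Complex.add_re, Complex.re_ofReal_mul] at hre
  rw [hRes1] at hre
  -- `2π L x^{1-β} k ≥ 2π S.re − Il.re`
  have hSq := squares_lower_bound (χ := χ) hq2 hβ1.le hx
  rw [← hS] at hSq
  have hL1pos : 0 < (χ.LFunction 1).re := by
    have := LFunction_ofReal_re_pos_of_forall_ne_zero χ hχ1 hq2 one_pos le_rfl fun σ h1 h2 ↦ by
      have hσ : σ = 1 := le_antisymm h2 h1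
      subst hσ
      exact DirichletCharacter.LFunction_ne_zero_of_one_le_re χ (Or.inl hχ1) (by simp)
    simpa using this
  have hπ := Real.pi_pos
  set Sm : ℝ := ∑ m ∈ Finset.range 200, (1 / ((m : ℝ) + 1) ^ 2 - 15 * ((m : ℝ) + 1) ^ 2 / x ^ 2) with hSm
  set Cl : ℝ := ((q : ℝ) ^ 2 * bigZ (5 / 2) ^ 2 / (16 * π ^ 4)) * x ^ (-3 / 2 - β) * hoffR (1 - β) *
      (π / Real.sqrt (35 / 4)) with hCl
  -- `B := S.re − Cl/(2π)` and `L x^{1-β} k ≥ B`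
  have hB : S.re - Cl / (2 * π) ≤ (χ.LFunction 1).re * (x ^ (1 - β) * k) := by
    have : 2 * π * (S.re - Cl / (2 * π)) ≤ 2 * π * ((χ.LFunction 1).re * (x ^ (1 - β) * k)) := by
      have e : 2 * π * (S.re - Cl / (2 * π)) = 2 * π * S.re - Cl := by field_simp
      rw [e]
      nlinarith [hre, hRes0, hRes2, hIl]
    exact le_of_mul_le_mul_left this (by positivity)
  -- `x^{1-β} k ≤ x^{1-β}/(720 (1-β))`
  have hxk : 0 < x ^ (1 - β) * k := mul_pos (Real.rpow_pos_of_pos hx0 _) hk0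
  have hkle : x ^ (1 - β) * k * (720 * (1 - β)) ≤ x ^ (1 - β) := by
    have hk' : k * (720 * (1 - β)) ≤ 1 := by
      rw [hk, one_div_mul_eq_div, div_le_one (by
        apply mul_pos (mul_pos (mul_pos (mul_pos (mul_pos hκ _) _) _) _) <;> linarith)]
      have h3 : (2 : ℝ) ≤ 3 - β := by linarith
      have h4 : (3 : ℝ) ≤ 4 - β := by linarith
      have h5 : (4 : ℝ) ≤ 5 - β := by linarith
      have h6 : (5 : ℝ) ≤ 6 - β := by linarith
      have h7 : (6 : ℝ) ≤ 7 - β := by linarith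
      calc 720 * (1 - β) = (1 - β) * 2 * 3 * 4 * 5 * 6 := by ring
        _ ≤ (1 - β) * (3 - β) * (4 - β) * (5 - β) * (6 - β) * (7 - β) := by gcongr
    nlinarith [Real.rpow_pos_of_pos hx0 (1 - β)]
  -- conclude
  have hxinv : x ^ (-(1 - β)) * x ^ (1 - β) = 1 := by
    rw [← Real.rpow_add hx0]; simp
  have hx52 : x ^ (-(1 - β)) * x ^ (-3 / 2 - β) = x ^ (-(5 / 2 : ℝ)) := by
    rw [← Real.rpow_add hx0]; congr 1; ring
  have hCE : x ^ (-(1 - β)) * (720 * (Cl / (2 * π))) = hoffErrConst q (1 - β) * x ^ (-(5 / 2 : ℝ)) := by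
    rw [hCl, hoffErrConst, ← hx52]
    field_simp
    ring
  -- target: (1-β) (x^{-κ} Sm − C_E x^{-5/2}) ≤ L
  have htarget : (1 - β) * (x ^ (-(1 - β)) * Sm - hoffErrConst q (1 - β) * x ^ (-(5 / 2 : ℝ))) ≤
      (1 - β) * (x ^ (-(1 - β)) * (720 * (S.re - Cl / (2 * π)))) := by
    rw [← hCE]
    have hxκ : 0 < x ^ (-(1 - β)) := Real.rpow_pos_of_pos hx0 _
    nlinarith [hSq, mul_pos hκ hxκ]
  refine htarget.trans ?_
  rcases le_or_gt 0 (S.re - Cl / (2 * π)) with hpos | hneg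
  · -- `L ≥ B/(x^{1-β} k) ≥ 720 (1-β) x^{-(1-β)} B`
    have h1 : (1 - β) * (x ^ (-(1 - β)) * (720 * (S.re - Cl / (2 * π)))) =
        (x ^ (-(1 - β)) * (720 * (1 - β))) * (S.re - Cl / (2 * π)) := by ring
    rw [h1]
    calc x ^ (-(1 - β)) * (720 * (1 - β)) * (S.re - Cl / (2 * π))
        ≤ x ^ (-(1 - β)) * (720 * (1 - β)) * ((χ.LFunction 1).re * (x ^ (1 - β) * k)) := by
          gcongr
      _ = (χ.LFunction 1).re * (x ^ (-(1 - β)) * (x ^ (1 - β) * k * (720 * (1 - β)))) := by ring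
      _ ≤ (χ.LFunction 1).re * (x ^ (-(1 - β)) * x ^ (1 - β)) := by
          gcongr
      _ = (χ.LFunction 1).re := by rw [hxinv, mul_one]
  · have hxκ : 0 < x ^ (-(1 - β)) := Real.rpow_pos_of_pos hx0 _
    have h1 : x ^ (-(1 - β)) * (720 * (S.re - Cl / (2 * π))) < 0 :=
      mul_neg_of_pos_of_neg hxκ (by linarith)
    exact ((mul_neg_of_pos_of_neg hκ h1).le).trans hL1pos.le

/-! ### The numerical constants of p. 169 -/

/-- `Σ_{m<n} (m+1)² = n(n+1)(2n+1)/6`. [folklore] -/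
private lemma sum_range_succ_sq (n : ℕ) :
    ∑ m ∈ Finset.range n, ((m : ℝ) + 1) ^ 2 = (n : ℝ) * (n + 1) * (2 * n + 1) / 6 := by
  induction n with
  | zero => simp
  | succ n ih => rw [Finset.sum_range_succ, ih]; push_cast; ring

/-- `1/(k+1)² ≤ 1/k − 1/(k+1)` for `k > 0`. [folklore] -/
private lemma inv_sq_le_sub {k : ℝ} (hk : 0 < k) : 1 / (k + 1) ^ 2 ≤ 1 / k - 1 / (k + 1) := by
  have h : 1 / k - 1 / (k + 1) - 1 / (k + 1) ^ 2 = 1 / (k * (k + 1) ^ 2) := by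
    field_simp; ring
  have h0 : 0 < 1 / (k * (k + 1) ^ 2) := by positivity
  linarith

/-- The tail `Σ_{i<N} 1/(i+201)² ≤ 1/200` (telescoping). [folklore] -/
private lemma sum_tail_inv_sq_le (N : ℕ) :
    ∑ i ∈ Finset.range N, 1 / ((i : ℝ) + 201) ^ 2 ≤ 1 / 200 := by
  have h : ∀ i ∈ Finset.range N, 1 / ((i : ℝ) + 201) ^ 2 ≤
      1 / ((i : ℝ) + 200) - 1 / (((i + 1 : ℕ) : ℝ) + 200) := by
    intro i _
    have := inv_sq_le_sub (k := (i : ℝ) + 200) (by positivity)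
    push_cast
    rw [show (i : ℝ) + 200 + 1 = (i : ℝ) + 201 by ring] at this
    rwa [show (i : ℝ) + 1 + 200 = (i : ℝ) + 201 by ring]
  refine (Finset.sum_le_sum h).trans ?_
  rw [Finset.sum_range_sub' (fun i : ℕ ↦ 1 / ((i : ℝ) + 200)) N]
  have : (0 : ℝ) ≤ 1 / ((N : ℝ) + 200) := by positivity
  push_cast
  linarith

/-- `Σ_{m ≤ 200} 1/m² ≥ 1.6399` (`= π²/6 −` a tail `≤ 1/200`; the source prints `Σ_{m ≤ 100}` and
`1.635`). [cite: Hoffstein1980SiegelTatuzawa, §2 proof of Lemma 1 (2) p. 169] -/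
theorem sum_inv_sq_200_ge : (1.6399 : ℝ) ≤ ∑ m ∈ Finset.range 200, 1 / ((m : ℝ) + 1) ^ 2 := by
  have hS := hasSum_zeta_two
  have h1 := hS.summable.sum_add_tsum_nat_add 201
  rw [hS.tsum_eq, Finset.sum_range_succ'] at h1
  have htail : ∑' i : ℕ, 1 / (((i + 201 : ℕ) : ℝ)) ^ 2 ≤ 1 / 200 := by
    refine Real.tsum_le_of_sum_range_le (fun _ ↦ by positivity) fun N ↦ ?_
    have := sum_tail_inv_sq_le N
    push_cast
    exact this
  have hπ : (9.8696 : ℝ) < π ^ 2 := by nlinarith [Real.pi_gt_d6, Real.pi_pos]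
  push_cast at h1
  simp only [ne_eq, OfNat.ofNat_ne_zero, not_false_eq_true, zero_pow, div_zero, add_zero] at h1
  linarith

/-- `a^{-1/2} ≤ b` from `1 ≤ a b²`. [folklore] -/
private lemma rpow_neg_half_le {a b : ℝ} (ha : 0 < a) (hb : 0 < b) (h : 1 ≤ a * b ^ 2) :
    a ^ (-(1 / 2 : ℝ)) ≤ b := by
  rw [Real.rpow_neg ha.le, ← Real.sqrt_eq_rpow, inv_le_comm₀ (Real.sqrt_pos.2 ha) hb,
    Real.le_sqrt (inv_pos.2 hb).le ha.le, inv_pow]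
  calc (b ^ 2)⁻¹ = (b ^ 2)⁻¹ * 1 := (mul_one _).symm
    _ ≤ (b ^ 2)⁻¹ * (a * b ^ 2) := by gcongr
    _ = a := by field_simp

/-- `Z₀(5/2) = ζ(5/2) ≤ 1 + 2^{-5/2} + ∫₂^∞ t^{-5/2} dt ≤ 1.4126` (the source uses `ζ(2)² ≥ ζ_k(5/2)`).
[cite: Hoffstein1980SiegelTatuzawa, §2 proof of Lemma 1 (1) p. 168] -/
theorem bigZ_five_halves_le : bigZ (5 / 2) ≤ 1.4126 := by
  rw [bigZ_eq_tsum (by norm_num)]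
  refine Real.tsum_le_of_sum_range_le (fun n ↦ by positivity) fun N ↦ ?_
  have hmono : ∑ n ∈ Finset.range N, ((n + 1 : ℕ) : ℝ) ^ (-(5 / 2 : ℝ)) ≤
      ∑ n ∈ Finset.range (max N 2), ((n + 1 : ℕ) : ℝ) ^ (-(5 / 2 : ℝ)) :=
    Finset.sum_le_sum_of_subset_of_nonneg (Finset.range_mono (le_max_left _ _))
      fun _ _ _ ↦ by positivity
  refine hmono.trans ?_
  obtain ⟨M, hMdef⟩ : ∃ M, M = max N 2 := ⟨_, rfl⟩
  have hM2 : 2 ≤ M := hMdef ▸ le_max_right _ _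
  rw [← hMdef, Finset.range_eq_Ico, ← Finset.sum_Ico_consecutive _ (Nat.zero_le 2) hM2]
  have hhead : ∑ n ∈ Finset.Ico 0 2, ((n + 1 : ℕ) : ℝ) ^ (-(5 / 2 : ℝ)) =
      1 + (32 : ℝ) ^ (-(1 / 2 : ℝ)) := by
    rw [show Finset.Ico 0 2 = {0, 1} by rfl, Finset.sum_pair (by norm_num)]
    norm_num
    rw [show (-(5 / 2 : ℝ)) = ((5 : ℕ) : ℝ) * (-(1 / 2 : ℝ)) by norm_num,
      Real.rpow_natCast_mul (by norm_num : (0 : ℝ) ≤ 2)]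
    norm_num
  have hanti : AntitoneOn (fun x : ℝ ↦ x ^ (-(5 / 2 : ℝ))) (Set.Icc ((2 : ℕ) : ℝ) ((M : ℕ) : ℝ)) := by
    intro x hx y _ hxy
    have hx2 : (2 : ℝ) ≤ x := by simpa using hx.1
    exact Real.rpow_le_rpow_of_nonpos (by linarith) hxy (by norm_num)
  have hcmp := AntitoneOn.sum_le_integral_Ico (f := fun x : ℝ ↦ x ^ (-(5 / 2 : ℝ))) hM2 hanti
  have hMr : (2 : ℝ) ≤ (M : ℝ) := by exact_mod_cast hM2
  have hint : ∫ x in ((2 : ℕ) : ℝ)..((M : ℕ) : ℝ), x ^ (-(5 / 2 : ℝ)) ≤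
      (2 / 3) * (8 : ℝ) ^ (-(1 / 2 : ℝ)) := by
    push_cast
    rw [integral_rpow (Or.inr ⟨by norm_num, by
      rw [Set.mem_uIcc]; push Not
      constructor <;> intro h <;> linarith⟩)]
    rw [show (-(5 / 2 : ℝ) + 1) = -(3 / 2) by norm_num]
    have hMpos : (0 : ℝ) ≤ (M : ℝ) ^ (-(3 / 2 : ℝ)) := by positivity
    have h8 : (2 : ℝ) ^ (-(3 / 2 : ℝ)) = (8 : ℝ) ^ (-(1 / 2 : ℝ)) := by
      rw [show (-(3 / 2 : ℝ)) = ((3 : ℕ) : ℝ) * (-(1 / 2 : ℝ)) by norm_num,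
        Real.rpow_natCast_mul (by norm_num : (0 : ℝ) ≤ 2)]
      norm_num
    rw [← h8]
    have : (((M : ℝ)) ^ (-(3 / 2 : ℝ)) - 2 ^ (-(3 / 2 : ℝ))) / (-(3 / 2 : ℝ)) =
        (2 / 3) * (2 ^ (-(3 / 2 : ℝ)) - (M : ℝ) ^ (-(3 / 2 : ℝ))) := by ring
    rw [this]
    linarith
  have h32 : (32 : ℝ) ^ (-(1 / 2 : ℝ)) ≤ 0.1768 := rpow_neg_half_le (by norm_num) (by norm_num) (by norm_num)
  have h8' : (8 : ℝ) ^ (-(1 / 2 : ℝ)) ≤ 0.3536 := rpow_neg_half_le (by norm_num) (by norm_num) (by norm_num)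
  rw [hhead]
  linarith

/-- `π⁴ > 97.4`. [folklore] -/
private lemma pi_pow_four_gt : (97.4 : ℝ) < π ^ 4 := by
  have h := Real.pi_gt_d6
  have h2 : (9.8696 : ℝ) < π ^ 2 := by nlinarith [Real.pi_pos]
  nlinarith [h2]

/-- `√(35/4) > 2.958`. [folklore] -/
private lemma sqrt_thirtyfive_fourths_gt : (2.958 : ℝ) < Real.sqrt (35 / 4) := by
  rw [Real.lt_sqrt (by norm_num)]; norm_num

/-- Monotone numerical bound for the error constant: for `κ ≤ κ₀ < 1/2`,
`C_E(q, κ) ≤ q² · 45·1.9955·R(κ₀)/(2·97.4·2.958)`.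
[cite: Hoffstein1980SiegelTatuzawa, §2 proof of Lemma 1 (1) p. 168] -/
theorem hoffErrConst_le {κ κ₀ : ℝ} (hκ : κ ≤ κ₀) (hκ₀ : κ₀ < 1 / 2) (q : ℕ) :
    hoffErrConst q κ ≤ (q : ℝ) ^ 2 *
      (45 * 1.9955 * ((5 / 4) / ((5 / 2 - κ₀) * (1 / 2 - κ₀))) / (2 * 97.4 * 2.958)) := by
  have hZ0 : 0 ≤ bigZ (5 / 2) := by
    have := norm_riemannZeta_le_bigZ (by norm_num : (1 : ℝ) < 5 / 2) 0
    exact (norm_nonneg _).trans this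
  have hZ : bigZ (5 / 2) ^ 2 ≤ 1.9955 := by nlinarith [bigZ_five_halves_le]
  have hR0 : 0 < (5 / 2 - κ₀) * (1 / 2 - κ₀) := mul_pos (by linarith) (by linarith)
  have hR : hoffR κ ≤ (5 / 4) / ((5 / 2 - κ₀) * (1 / 2 - κ₀)) := by
    unfold hoffR
    exact div_le_div_of_nonneg_left (by norm_num) hR0 (by nlinarith)
  have hRnn : 0 ≤ hoffR κ := by
    unfold hoffR; exact div_nonneg (by norm_num) (mul_pos (by linarith) (by linarith)).le
  have hden : (2 * 97.4 * 2.958 : ℝ) ≤ 2 * π ^ 4 * Real.sqrt (35 / 4) := by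
    have h1 := pi_pow_four_gt
    have h2 := sqrt_thirtyfive_fourths_gt
    nlinarith
  have hden0 : (0 : ℝ) < 2 * 97.4 * 2.958 := by norm_num
  unfold hoffErrConst
  calc 45 * (q : ℝ) ^ 2 * bigZ (5 / 2) ^ 2 * hoffR κ / (2 * π ^ 4 * Real.sqrt (35 / 4))
      ≤ 45 * (q : ℝ) ^ 2 * 1.9955 * ((5 / 4) / ((5 / 2 - κ₀) * (1 / 2 - κ₀))) / (2 * 97.4 * 2.958) := by
        gcongr
    _ = _ := by ring

/-- `e^{−(14/15)/11.657} ≥ 0.92305` (Taylor to order 3). [folklore] -/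
private lemma exp_case1_ge : (0.92305 : ℝ) ≤ Real.exp (-(14 / 15 / 11.657)) := by
  have h := Real.exp_bound (x := -(14 / 15 / 11.657 : ℝ)) (by rw [abs_le]; constructor <;> norm_num)
    (n := 4) (by norm_num)
  rw [abs_le] at h
  have h2 := h.1
  simp only [Finset.sum_range_succ, Finset.sum_range_zero, Nat.factorial, Nat.succ_eq_add_one] at h2
  norm_num at h2
  linarith

/-- `e^{−(13/15)·1.1} ≥ 0.3854` (Taylor to order 7). [folklore] -/
private lemma exp_case2_ge : (0.3854 : ℝ) ≤ Real.exp (-(13 / 15 * 1.1)) := by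
  have h := Real.exp_bound (x := -(13 / 15 * 1.1 : ℝ)) (by rw [abs_le]; constructor <;> norm_num)
    (n := 8) (by norm_num)
  rw [abs_le] at h
  have h2 := h.1
  simp only [Finset.sum_range_succ, Finset.sum_range_zero, Nat.factorial, Nat.succ_eq_add_one] at h2
  norm_num at h2
  linarith

/-- `q ≥ 10⁶`, `e ≥ 0` ⟹ `q^e ≥ 10^{6e}`. [folklore] -/
private lemma rpow_ge_of_ge_ten6 {r : ℝ} (hr : 10 ^ 6 ≤ r) {e : ℝ} (he : 0 ≤ e) :
    (10 : ℝ) ^ (6 * e) ≤ r ^ e := by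
  calc (10 : ℝ) ^ (6 * e) = ((10 : ℝ) ^ (6 : ℕ)) ^ e := by
        rw [show (6 : ℝ) * e = ((6 : ℕ) : ℝ) * e by norm_num, Real.rpow_natCast_mul (by norm_num)]
    _ ≤ r ^ e := Real.rpow_le_rpow (by norm_num) hr he

/-- `q ≥ 10⁶`, `e ≥ 0` ⟹ `q^{−e} ≤ 10^{−6e}`. [folklore] -/
private lemma rpow_le_of_ge_ten6 {r : ℝ} (hr : 10 ^ 6 ≤ r) {e : ℝ} (he : 0 ≤ e) :
    r ^ (-e) ≤ (10 : ℝ) ^ (-(6 * e)) := by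
  have hr0 : 0 < r := lt_of_lt_of_le (by norm_num) hr
  rw [Real.rpow_neg hr0.le, Real.rpow_neg (by norm_num)]
  exact inv_anti₀ (by positivity) (rpow_ge_of_ge_ten6 hr he)

/-- `log q > 19 log 2 > 13.1697` for `q > 10⁶`. [folklore] -/
private lemma log_gt_of_gt_ten6 {r : ℝ} (hr : 10 ^ 6 < r) : (13.1697 : ℝ) < Real.log r := by
  have h19 : Real.log ((2 : ℝ) ^ 19) < Real.log r :=
    Real.log_lt_log (by positivity) (by linarith [show ((2 : ℝ) ^ 19) < 10 ^ 6 by norm_num])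
  rw [Real.log_pow] at h19
  push_cast at h19
  linarith [Real.log_two_gt_d9]

/-! ### Lemma 1 -/

open Literature.NumberTheory.LFunctions.DirichletAbel in
/-- **Lemma 1, first assertion** (Hoffstein): for a real primitive `χ` mod `q > 10⁶`, if `L(s, χ) ≠ 0`
for real `s ∈ (β, 1)` with `1 − β < 1/(11.657 log q)`, then `L(1, χ) > 1.507 (1 − β)`.
(Choice `x = q^{14/15}`; the source takes `x = |d|^{.92}`.)
[cite: Hoffstein1980SiegelTatuzawa, §2 Lemma 1 p. 168, proof p. 169] -/
theorem hoffstein_lemma1_part1 (hχ : χ.IsPrimitive) (hquad : χ.IsQuadratic)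
    (hq6 : (10 ^ 6 : ℝ) < q) {β : ℝ} (hβ1 : β < 1) (hκq : 1 - β < 1 / (11.657 * Real.log q))
    (hz : ∀ σ : ℝ, β < σ → σ < 1 → χ.LFunction σ ≠ 0) :
    1.507 * (1 - β) < (χ.LFunction 1).re := by
  have hq1r : (1 : ℝ) < q := lt_trans (by norm_num) hq6
  have hq : 1 < q := by exact_mod_cast hq1r
  have hq0 : (0 : ℝ) < q := by linarith
  have hχ1 := ne_one_of_isPrimitive'' hχ hq
  have hq2 : χ ^ 2 = 1 := hquad.sq_eq_one
  have hlog := log_gt_of_gt_ten6 hq6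
  have hlog0 : 0 < Real.log q := by linarith
  have hκ0 : 0 < 1 - β := by linarith
  have hκlog : (1 - β) * Real.log q < 1 / 11.657 := by
    have := hκq
    rw [lt_div_iff₀ (by positivity)] at this
    rw [lt_div_iff₀ (by norm_num)]
    linarith
  have hκ1 : 1 - β < 0.0066 := by
    have h3 : (1 - β) * 13.1697 < 1 / 11.657 := lt_trans (by nlinarith) hκlog
    have : (1 / 11.657 : ℝ) < 0.0066 * 13.1697 := by norm_num
    nlinarith
  have hβ0 : 1 / 2 < β := by linarith
  -- `L(β, χ) ≥ 0`: positive on `(β, 1]`, continuous at `β`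
  have hpos : ∀ σ : ℝ, β < σ → σ ≤ 1 → 0 < (χ.LFunction σ).re := fun σ h1 h2 ↦
    LFunction_ofReal_re_pos_of_forall_ne_zero χ hχ1 hq2 (by linarith) h2 fun τ hτ1 hτ2 ↦ by
      rcases eq_or_lt_of_le hτ2 with rfl | hlt
      · rw [ofReal_one]; exact LFunction_apply_one_ne_zero hχ1
      · exact hz τ (by linarith) hlt
  have hLβ : 0 ≤ (χ.LFunction β).re := by
    have hcont : Continuous fun σ : ℝ ↦ (χ.LFunction σ).re :=
      continuous_re.comp ((differentiable_LFunction hχ1).continuous.comp continuous_ofReal)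
    have ht : Tendsto (fun σ : ℝ ↦ (χ.LFunction σ).re) (𝓝[>] β) (𝓝 ((χ.LFunction β).re)) :=
      tendsto_nhdsWithin_of_tendsto_nhds (hcont.tendsto β)
    refine ge_of_tendsto ht ?_
    filter_upwards [Ioo_mem_nhdsGT hβ1] with σ hσ
    exact (hpos σ hσ.1 hσ.2.le).le
  -- the choice `x = q^{14/15}`
  obtain ⟨x, hxdef⟩ : ∃ x : ℝ, x = (q : ℝ) ^ (14 / 15 : ℝ) := ⟨_, rfl⟩
  have hx0 : 0 < x := hxdef ▸ Real.rpow_pos_of_pos hq0 _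
  have hq6' : (10 : ℝ) ^ 6 ≤ q := hq6.le
  have hx5 : (100000 : ℝ) ≤ x := by
    have h1 := rpow_ge_of_ge_ten6 hq6' (e := 14 / 15) (by norm_num)
    have h2 : (10 : ℝ) ^ (5 : ℝ) ≤ (10 : ℝ) ^ (6 * (14 / 15) : ℝ) :=
      Real.rpow_le_rpow_of_exponent_le (by norm_num) (by norm_num)
    have h3 : (10 : ℝ) ^ (5 : ℝ) = 100000 := by
      rw [show (5 : ℝ) = ((5 : ℕ) : ℝ) by norm_num, Real.rpow_natCast]; norm_num
    rw [hxdef]; linarith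
  have hM := hoffstein_master hq hχ hquad hβ0 hβ1 hLβ (x := x) (by linarith)
  -- (i) `x^{-(1-β)} ≥ e^{-(14/15)/11.657} ≥ 0.92305`
  have hxκ : (0.92305 : ℝ) ≤ x ^ (-(1 - β)) := by
    refine exp_case1_ge.trans ?_
    rw [Real.rpow_def_of_pos hx0, Real.exp_le_exp, hxdef, Real.log_rpow hq0]
    have : 14 / 15 * Real.log q * (1 - β) ≤ 14 / 15 / 11.657 := by
      rw [mul_assoc, mul_comm (Real.log q), div_eq_mul_one_div (14 / 15 : ℝ)]
      exact mul_le_mul_of_nonneg_left hκlog.le (by norm_num)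
    linarith
  -- (ii) the squares sum `≥ 1.63949`
  have hx2 : (10 : ℝ) ^ 11 ≤ x ^ 2 := by
    have h1 := rpow_ge_of_ge_ten6 hq6' (e := 2 * (14 / 15)) (by norm_num)
    have h2 : (10 : ℝ) ^ (11 : ℝ) ≤ (10 : ℝ) ^ (6 * (2 * (14 / 15)) : ℝ) :=
      Real.rpow_le_rpow_of_exponent_le (by norm_num) (by norm_num)
    have h3 : (10 : ℝ) ^ (11 : ℝ) = 10 ^ 11 := by
      rw [show (11 : ℝ) = ((11 : ℕ) : ℝ) by norm_num, Real.rpow_natCast]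
    have h4 : x ^ 2 = (q : ℝ) ^ (2 * (14 / 15) : ℝ) := by
      rw [hxdef, ← Real.rpow_natCast, ← Real.rpow_mul hq0.le]; norm_num
    rw [h4]; linarith
  have hSm : (1.63949 : ℝ) ≤
      ∑ m ∈ Finset.range 200, (1 / ((m : ℝ) + 1) ^ 2 - 15 * ((m : ℝ) + 1) ^ 2 / x ^ 2) := by
    rw [Finset.sum_sub_distrib]
    have hA := sum_inv_sq_200_ge
    have hB : ∑ m ∈ Finset.range 200, 15 * ((m : ℝ) + 1) ^ 2 / x ^ 2 = 15 * 2686700 / x ^ 2 := by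
      rw [← Finset.sum_div, ← Finset.mul_sum, sum_range_succ_sq]; norm_num
    rw [hB]
    have : 15 * 2686700 / x ^ 2 ≤ (0.00041 : ℝ) := by
      rw [div_le_iff₀ (by positivity)]; linarith
    linarith
  -- (iii) the error term `≤ 0.001584`
  have hE : hoffErrConst q (1 - β) * x ^ (-(5 / 2 : ℝ)) ≤ 0.001584 := by
    have hC := hoffErrConst_le hκ1.le (by norm_num) q
    have hnum : (45 * 1.9955 * ((5 / 4) / ((5 / 2 - 0.0066) * (1 / 2 - 0.0066))) /
        (2 * 97.4 * 2.958) : ℝ) ≤ 0.1584 := by norm_num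
    have hx52 : x ^ (-(5 / 2 : ℝ)) = (q : ℝ) ^ (-(7 / 3 : ℝ)) := by
      rw [hxdef, ← Real.rpow_mul hq0.le]; norm_num
    have hq13 : (q : ℝ) ^ 2 * (q : ℝ) ^ (-(7 / 3 : ℝ)) = (q : ℝ) ^ (-(1 / 3 : ℝ)) := by
      rw [← Real.rpow_natCast, ← Real.rpow_add hq0]; norm_num
    have hq13' : (q : ℝ) ^ (-(1 / 3 : ℝ)) ≤ 1 / 100 := by
      have := rpow_le_of_ge_ten6 hq6' (e := 1 / 3) (by norm_num)
      have h2 : (10 : ℝ) ^ (-(6 * (1 / 3)) : ℝ) = 1 / 100 := by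
        rw [show (-(6 * (1 / 3)) : ℝ) = -((2 : ℕ) : ℝ) by norm_num, Real.rpow_neg (by norm_num),
          Real.rpow_natCast]; norm_num
      linarith
    calc hoffErrConst q (1 - β) * x ^ (-(5 / 2 : ℝ))
        ≤ (q : ℝ) ^ 2 * 0.1584 * x ^ (-(5 / 2 : ℝ)) := by
          gcongr
          exact hC.trans (by gcongr)
      _ = 0.1584 * ((q : ℝ) ^ 2 * (q : ℝ) ^ (-(7 / 3 : ℝ))) := by rw [hx52]; ring
      _ ≤ 0.1584 * (1 / 100) := by rw [hq13]; gcongr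
      _ = 0.001584 := by norm_num
  -- assembly
  have hS0 : (0 : ℝ) ≤ ∑ m ∈ Finset.range 200, (1 / ((m : ℝ) + 1) ^ 2 - 15 * ((m : ℝ) + 1) ^ 2 / x ^ 2) :=
    le_trans (by norm_num) hSm
  have hprod : (0.92305 * 1.63949 : ℝ) ≤ x ^ (-(1 - β)) *
      ∑ m ∈ Finset.range 200, (1 / ((m : ℝ) + 1) ^ 2 - 15 * ((m : ℝ) + 1) ^ 2 / x ^ 2) :=
    mul_le_mul hxκ hSm (by norm_num) (le_trans (by norm_num) hxκ)
  have hbr : (1.507 : ℝ) < x ^ (-(1 - β)) *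
      ∑ m ∈ Finset.range 200, (1 / ((m : ℝ) + 1) ^ 2 - 15 * ((m : ℝ) + 1) ^ 2 / x ^ 2) -
      hoffErrConst q (1 - β) * x ^ (-(5 / 2 : ℝ)) := by
    norm_num at hprod ⊢; linarith
  calc 1.507 * (1 - β) = (1 - β) * 1.507 := mul_comm _ _
    _ < (1 - β) * (x ^ (-(1 - β)) *
        ∑ m ∈ Finset.range 200, (1 / ((m : ℝ) + 1) ^ 2 - 15 * ((m : ℝ) + 1) ^ 2 / x ^ 2) -
        hoffErrConst q (1 - β) * x ^ (-(5 / 2 : ℝ))) := mul_lt_mul_of_pos_left hbr hκ0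
    _ ≤ (χ.LFunction 1).re := hM

open Literature.NumberTheory.LFunctions.DirichletAbel in
/-- **Lemma 1, second assertion** (Hoffstein): for a real primitive `χ` mod `q > 10⁶`, if
`L(s, χ) ≠ 0` for real `s ∈ (0, 1)`, then `L(1, χ) > 1/(1.502 log q)`.
(Choice `β = 1 − 1.1/log q`, `x = q^{13/15}`; the source takes `c₆ = 1.1`, `A = .87`.)
[cite: Hoffstein1980SiegelTatuzawa, §2 Lemma 1 p. 168, proof p. 169] -/
theorem hoffstein_lemma1_part2 (hχ : χ.IsPrimitive) (hquad : χ.IsQuadratic)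
    (hq6 : (10 ^ 6 : ℝ) < q) (hz : ∀ σ : ℝ, 0 < σ → σ < 1 → χ.LFunction σ ≠ 0) :
    1 / (1.502 * Real.log q) < (χ.LFunction 1).re := by
  have hq1r : (1 : ℝ) < q := lt_trans (by norm_num) hq6
  have hq : 1 < q := by exact_mod_cast hq1r
  have hq0 : (0 : ℝ) < q := by linarith
  have hχ1 := ne_one_of_isPrimitive'' hχ hq
  have hq2 : χ ^ 2 = 1 := hquad.sq_eq_one
  have hlog := log_gt_of_gt_ten6 hq6
  have hlog0 : 0 < Real.log q := by linarith
  -- the choice `β = 1 − 1.1/log q`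
  obtain ⟨β, hβdef⟩ : ∃ β : ℝ, β = 1 - 1.1 / Real.log q := ⟨_, rfl⟩
  have hκ : 1 - β = 1.1 / Real.log q := by rw [hβdef]; ring
  have hκ0 : 0 < 1 - β := by rw [hκ]; positivity
  have hκ1 : 1 - β < 0.084 := by
    rw [hκ, div_lt_iff₀ hlog0]; linarith
  have hβ1 : β < 1 := by linarith
  have hβ0 : 1 / 2 < β := by linarith
  have hβpos : 0 < β := by linarith
  have hLβ : 0 ≤ (χ.LFunction β).re :=
    (LFunction_ofReal_re_pos_of_forall_ne_zero χ hχ1 hq2 hβpos hβ1.le fun τ hτ1 hτ2 ↦ by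
      rcases eq_or_lt_of_le hτ2 with rfl | hlt
      · rw [ofReal_one]; exact LFunction_apply_one_ne_zero hχ1
      · exact hz τ (by linarith) hlt).le
  -- the choice `x = q^{13/15}`
  obtain ⟨x, hxdef⟩ : ∃ x : ℝ, x = (q : ℝ) ^ (13 / 15 : ℝ) := ⟨_, rfl⟩
  have hx0 : 0 < x := hxdef ▸ Real.rpow_pos_of_pos hq0 _
  have hq6' : (10 : ℝ) ^ 6 ≤ q := hq6.le
  have hx5 : (100000 : ℝ) ≤ x := by
    have h1 := rpow_ge_of_ge_ten6 hq6' (e := 13 / 15) (by norm_num)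
    have h2 : (10 : ℝ) ^ (5 : ℝ) ≤ (10 : ℝ) ^ (6 * (13 / 15) : ℝ) :=
      Real.rpow_le_rpow_of_exponent_le (by norm_num) (by norm_num)
    have h3 : (10 : ℝ) ^ (5 : ℝ) = 100000 := by
      rw [show (5 : ℝ) = ((5 : ℕ) : ℝ) by norm_num, Real.rpow_natCast]; norm_num
    rw [hxdef]; linarith
  have hM := hoffstein_master hq hχ hquad hβ0 hβ1 hLβ (x := x) (by linarith)
  -- (i) `x^{-(1-β)} = e^{-(13/15)·1.1} ≥ 0.3854`
  have hxκ : (0.3854 : ℝ) ≤ x ^ (-(1 - β)) := by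
    rw [Real.rpow_def_of_pos hx0, hxdef, Real.log_rpow hq0, hκ]
    have : (13 / 15 : ℝ) * Real.log q * (-(1.1 / Real.log q)) = -(13 / 15 * 1.1) := by
      field_simp
    rw [this]; exact exp_case2_ge
  -- (ii) the squares sum `≥ 1.6358`
  have hx2 : (10 : ℝ) ^ 10 ≤ x ^ 2 := by
    have h1 := rpow_ge_of_ge_ten6 hq6' (e := 2 * (13 / 15)) (by norm_num)
    have h2 : (10 : ℝ) ^ (10 : ℝ) ≤ (10 : ℝ) ^ (6 * (2 * (13 / 15)) : ℝ) :=
      Real.rpow_le_rpow_of_exponent_le (by norm_num) (by norm_num)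
    have h3 : (10 : ℝ) ^ (10 : ℝ) = 10 ^ 10 := by
      rw [show (10 : ℝ) = ((10 : ℕ) : ℝ) by norm_num, Real.rpow_natCast]
    have h4 : x ^ 2 = (q : ℝ) ^ (2 * (13 / 15) : ℝ) := by
      rw [hxdef, ← Real.rpow_natCast, ← Real.rpow_mul hq0.le]; norm_num
    rw [h4]; linarith
  have hSm : (1.6358 : ℝ) ≤
      ∑ m ∈ Finset.range 200, (1 / ((m : ℝ) + 1) ^ 2 - 15 * ((m : ℝ) + 1) ^ 2 / x ^ 2) := by
    rw [Finset.sum_sub_distrib]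
    have hA := sum_inv_sq_200_ge
    have hB : ∑ m ∈ Finset.range 200, 15 * ((m : ℝ) + 1) ^ 2 / x ^ 2 = 15 * 2686700 / x ^ 2 := by
      rw [← Finset.sum_div, ← Finset.mul_sum, sum_range_succ_sq]; norm_num
    rw [hB]
    have : 15 * 2686700 / x ^ 2 ≤ (0.0041 : ℝ) := by
      rw [div_le_iff₀ (by positivity)]; linarith
    linarith
  -- (iii) the error term `≤ 0.01939`
  have hE : hoffErrConst q (1 - β) * x ^ (-(5 / 2 : ℝ)) ≤ 0.01939 := by
    have hC := hoffErrConst_le hκ1.le (by norm_num) q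
    have hnum : (45 * 1.9955 * ((5 / 4) / ((5 / 2 - 0.084) * (1 / 2 - 0.084))) /
        (2 * 97.4 * 2.958) : ℝ) ≤ 0.1939 := by norm_num
    have hx52 : x ^ (-(5 / 2 : ℝ)) = (q : ℝ) ^ (-(13 / 6 : ℝ)) := by
      rw [hxdef, ← Real.rpow_mul hq0.le]; norm_num
    have hq16 : (q : ℝ) ^ 2 * (q : ℝ) ^ (-(13 / 6 : ℝ)) = (q : ℝ) ^ (-(1 / 6 : ℝ)) := by
      rw [← Real.rpow_natCast, ← Real.rpow_add hq0]; norm_num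
    have hq16' : (q : ℝ) ^ (-(1 / 6 : ℝ)) ≤ 1 / 10 := by
      have := rpow_le_of_ge_ten6 hq6' (e := 1 / 6) (by norm_num)
      have h2 : (10 : ℝ) ^ (-(6 * (1 / 6)) : ℝ) = 1 / 10 := by
        rw [show (-(6 * (1 / 6)) : ℝ) = -((1 : ℕ) : ℝ) by norm_num, Real.rpow_neg (by norm_num),
          Real.rpow_natCast]; norm_num
      linarith
    calc hoffErrConst q (1 - β) * x ^ (-(5 / 2 : ℝ))
        ≤ (q : ℝ) ^ 2 * 0.1939 * x ^ (-(5 / 2 : ℝ)) := by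
          gcongr
          exact hC.trans (by gcongr)
      _ = 0.1939 * ((q : ℝ) ^ 2 * (q : ℝ) ^ (-(13 / 6 : ℝ))) := by rw [hx52]; ring
      _ ≤ 0.1939 * (1 / 10) := by rw [hq16]; gcongr
      _ = 0.01939 := by norm_num
  -- assembly
  have hprod : (0.3854 * 1.6358 : ℝ) ≤ x ^ (-(1 - β)) *
      ∑ m ∈ Finset.range 200, (1 / ((m : ℝ) + 1) ^ 2 - 15 * ((m : ℝ) + 1) ^ 2 / x ^ 2) :=
    mul_le_mul hxκ hSm (by norm_num) (le_trans (by norm_num) hxκ)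
  have hbr : (0.61104 : ℝ) ≤ x ^ (-(1 - β)) *
      ∑ m ∈ Finset.range 200, (1 / ((m : ℝ) + 1) ^ 2 - 15 * ((m : ℝ) + 1) ^ 2 / x ^ 2) -
      hoffErrConst q (1 - β) * x ^ (-(5 / 2 : ℝ)) := by
    norm_num at hprod ⊢; linarith
  have hfin : 1 / (1.502 * Real.log q) < (1 - β) * 0.61104 := by
    rw [hκ, div_lt_iff₀ (by positivity)]
    have : 1.1 / Real.log q * 0.61104 * (1.502 * Real.log q) = 1.1 * 0.61104 * 1.502 := by
      field_simp
    rw [this]; norm_num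
  calc 1 / (1.502 * Real.log q) < (1 - β) * 0.61104 := hfin
    _ ≤ (1 - β) * (x ^ (-(1 - β)) *
        ∑ m ∈ Finset.range 200, (1 / ((m : ℝ) + 1) ^ 2 - 15 * ((m : ℝ) + 1) ^ 2 / x ^ 2) -
        hoffErrConst q (1 - β) * x ^ (-(5 / 2 : ℝ))) := mul_le_mul_of_nonneg_left hbr hκ0.le
    _ ≤ (χ.LFunction 1).re := hM

open Literature.NumberTheory.LFunctions.DirichletAbel in
/-- **Lemma 1, first assertion, with the slack of the printed proof kept** (appended 2026-08-28 for the
§3 discharge): for a real primitive `χ` mod `q > 10⁶`, if `L(s, χ) ≠ 0` for real `s ∈ (β, 1)` with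
`1 − β < 1/(11.657 log q)`, then `L(1, χ) > 1.511 (1 − β)` (same proof and numerics as
`hoffstein_lemma1_part1`: `0.92305 · 1.63949 − 0.001584 = 1.5117…`; the source prints the rounded
`1.507`, which loses the implication `L(1,χ′) < 1/(7.735 log|d′|) ⇒ (6)` of §3 p. 170 by a hair, since
`1.507/11.657 = 1/7.7352 < 1/7.735`; `1.511/11.657 = 1/7.715` restores it, see
`exists_realZero_of_lOne_lt`). [cite: Hoffstein1980SiegelTatuzawa, §2 Lemma 1 p. 168, proof p. 169; §3 (5)–(6) p. 170] -/
theorem hoffstein_lemma1_part1_sharp (hχ : χ.IsPrimitive) (hquad : χ.IsQuadratic)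
    (hq6 : (10 ^ 6 : ℝ) < q) {β : ℝ} (hβ1 : β < 1) (hκq : 1 - β < 1 / (11.657 * Real.log q))
    (hz : ∀ σ : ℝ, β < σ → σ < 1 → χ.LFunction σ ≠ 0) :
    1.511 * (1 - β) < (χ.LFunction 1).re := by
  have hq1r : (1 : ℝ) < q := lt_trans (by norm_num) hq6
  have hq : 1 < q := by exact_mod_cast hq1r
  have hq0 : (0 : ℝ) < q := by linarith
  have hχ1 := ne_one_of_isPrimitive'' hχ hq
  have hq2 : χ ^ 2 = 1 := hquad.sq_eq_one
  have hlog := log_gt_of_gt_ten6 hq6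
  have hlog0 : 0 < Real.log q := by linarith
  have hκ0 : 0 < 1 - β := by linarith
  have hκlog : (1 - β) * Real.log q < 1 / 11.657 := by
    have := hκq
    rw [lt_div_iff₀ (by positivity)] at this
    rw [lt_div_iff₀ (by norm_num)]
    linarith
  have hκ1 : 1 - β < 0.0066 := by
    have h3 : (1 - β) * 13.1697 < 1 / 11.657 := lt_trans (by nlinarith) hκlog
    have : (1 / 11.657 : ℝ) < 0.0066 * 13.1697 := by norm_num
    nlinarith
  have hβ0 : 1 / 2 < β := by linarith
  -- `L(β, χ) ≥ 0`: positive on `(β, 1]`, continuous at `β`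
  have hpos : ∀ σ : ℝ, β < σ → σ ≤ 1 → 0 < (χ.LFunction σ).re := fun σ h1 h2 ↦
    LFunction_ofReal_re_pos_of_forall_ne_zero χ hχ1 hq2 (by linarith) h2 fun τ hτ1 hτ2 ↦ by
      rcases eq_or_lt_of_le hτ2 with rfl | hlt
      · rw [ofReal_one]; exact LFunction_apply_one_ne_zero hχ1
      · exact hz τ (by linarith) hlt
  have hLβ : 0 ≤ (χ.LFunction β).re := by
    have hcont : Continuous fun σ : ℝ ↦ (χ.LFunction σ).re :=
      continuous_re.comp ((differentiable_LFunction hχ1).continuous.comp continuous_ofReal)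
    have ht : Tendsto (fun σ : ℝ ↦ (χ.LFunction σ).re) (𝓝[>] β) (𝓝 ((χ.LFunction β).re)) :=
      tendsto_nhdsWithin_of_tendsto_nhds (hcont.tendsto β)
    refine ge_of_tendsto ht ?_
    filter_upwards [Ioo_mem_nhdsGT hβ1] with σ hσ
    exact (hpos σ hσ.1 hσ.2.le).le
  -- the choice `x = q^{14/15}`
  obtain ⟨x, hxdef⟩ : ∃ x : ℝ, x = (q : ℝ) ^ (14 / 15 : ℝ) := ⟨_, rfl⟩
  have hx0 : 0 < x := hxdef ▸ Real.rpow_pos_of_pos hq0 _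
  have hq6' : (10 : ℝ) ^ 6 ≤ q := hq6.le
  have hx5 : (100000 : ℝ) ≤ x := by
    have h1 := rpow_ge_of_ge_ten6 hq6' (e := 14 / 15) (by norm_num)
    have h2 : (10 : ℝ) ^ (5 : ℝ) ≤ (10 : ℝ) ^ (6 * (14 / 15) : ℝ) :=
      Real.rpow_le_rpow_of_exponent_le (by norm_num) (by norm_num)
    have h3 : (10 : ℝ) ^ (5 : ℝ) = 100000 := by
      rw [show (5 : ℝ) = ((5 : ℕ) : ℝ) by norm_num, Real.rpow_natCast]; norm_num
    rw [hxdef]; linarith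
  have hM := hoffstein_master hq hχ hquad hβ0 hβ1 hLβ (x := x) (by linarith)
  -- (i) `x^{-(1-β)} ≥ e^{-(14/15)/11.657} ≥ 0.92305`
  have hxκ : (0.92305 : ℝ) ≤ x ^ (-(1 - β)) := by
    refine exp_case1_ge.trans ?_
    rw [Real.rpow_def_of_pos hx0, Real.exp_le_exp, hxdef, Real.log_rpow hq0]
    have : 14 / 15 * Real.log q * (1 - β) ≤ 14 / 15 / 11.657 := by
      rw [mul_assoc, mul_comm (Real.log q), div_eq_mul_one_div (14 / 15 : ℝ)]
      exact mul_le_mul_of_nonneg_left hκlog.le (by norm_num)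
    linarith
  -- (ii) the squares sum `≥ 1.63949`
  have hx2 : (10 : ℝ) ^ 11 ≤ x ^ 2 := by
    have h1 := rpow_ge_of_ge_ten6 hq6' (e := 2 * (14 / 15)) (by norm_num)
    have h2 : (10 : ℝ) ^ (11 : ℝ) ≤ (10 : ℝ) ^ (6 * (2 * (14 / 15)) : ℝ) :=
      Real.rpow_le_rpow_of_exponent_le (by norm_num) (by norm_num)
    have h3 : (10 : ℝ) ^ (11 : ℝ) = 10 ^ 11 := by
      rw [show (11 : ℝ) = ((11 : ℕ) : ℝ) by norm_num, Real.rpow_natCast]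
    have h4 : x ^ 2 = (q : ℝ) ^ (2 * (14 / 15) : ℝ) := by
      rw [hxdef, ← Real.rpow_natCast, ← Real.rpow_mul hq0.le]; norm_num
    rw [h4]; linarith
  have hSm : (1.63949 : ℝ) ≤
      ∑ m ∈ Finset.range 200, (1 / ((m : ℝ) + 1) ^ 2 - 15 * ((m : ℝ) + 1) ^ 2 / x ^ 2) := by
    rw [Finset.sum_sub_distrib]
    have hA := sum_inv_sq_200_ge
    have hB : ∑ m ∈ Finset.range 200, 15 * ((m : ℝ) + 1) ^ 2 / x ^ 2 = 15 * 2686700 / x ^ 2 := by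
      rw [← Finset.sum_div, ← Finset.mul_sum, sum_range_succ_sq]; norm_num
    rw [hB]
    have : 15 * 2686700 / x ^ 2 ≤ (0.00041 : ℝ) := by
      rw [div_le_iff₀ (by positivity)]; linarith
    linarith
  -- (iii) the error term `≤ 0.001584`
  have hE : hoffErrConst q (1 - β) * x ^ (-(5 / 2 : ℝ)) ≤ 0.001584 := by
    have hC := hoffErrConst_le hκ1.le (by norm_num) q
    have hnum : (45 * 1.9955 * ((5 / 4) / ((5 / 2 - 0.0066) * (1 / 2 - 0.0066))) /
        (2 * 97.4 * 2.958) : ℝ) ≤ 0.1584 := by norm_num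
    have hx52 : x ^ (-(5 / 2 : ℝ)) = (q : ℝ) ^ (-(7 / 3 : ℝ)) := by
      rw [hxdef, ← Real.rpow_mul hq0.le]; norm_num
    have hq13 : (q : ℝ) ^ 2 * (q : ℝ) ^ (-(7 / 3 : ℝ)) = (q : ℝ) ^ (-(1 / 3 : ℝ)) := by
      rw [← Real.rpow_natCast, ← Real.rpow_add hq0]; norm_num
    have hq13' : (q : ℝ) ^ (-(1 / 3 : ℝ)) ≤ 1 / 100 := by
      have := rpow_le_of_ge_ten6 hq6' (e := 1 / 3) (by norm_num)
      have h2 : (10 : ℝ) ^ (-(6 * (1 / 3)) : ℝ) = 1 / 100 := by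
        rw [show (-(6 * (1 / 3)) : ℝ) = -((2 : ℕ) : ℝ) by norm_num, Real.rpow_neg (by norm_num),
          Real.rpow_natCast]; norm_num
      linarith
    calc hoffErrConst q (1 - β) * x ^ (-(5 / 2 : ℝ))
        ≤ (q : ℝ) ^ 2 * 0.1584 * x ^ (-(5 / 2 : ℝ)) := by
          gcongr
          exact hC.trans (by gcongr)
      _ = 0.1584 * ((q : ℝ) ^ 2 * (q : ℝ) ^ (-(7 / 3 : ℝ))) := by rw [hx52]; ring
      _ ≤ 0.1584 * (1 / 100) := by rw [hq13]; gcongr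
      _ = 0.001584 := by norm_num
  -- assembly
  have hS0 : (0 : ℝ) ≤ ∑ m ∈ Finset.range 200, (1 / ((m : ℝ) + 1) ^ 2 - 15 * ((m : ℝ) + 1) ^ 2 / x ^ 2) :=
    le_trans (by norm_num) hSm
  have hprod : (0.92305 * 1.63949 : ℝ) ≤ x ^ (-(1 - β)) *
      ∑ m ∈ Finset.range 200, (1 / ((m : ℝ) + 1) ^ 2 - 15 * ((m : ℝ) + 1) ^ 2 / x ^ 2) :=
    mul_le_mul hxκ hSm (by norm_num) (le_trans (by norm_num) hxκ)
  have hbr : (1.511 : ℝ) < x ^ (-(1 - β)) *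
      ∑ m ∈ Finset.range 200, (1 / ((m : ℝ) + 1) ^ 2 - 15 * ((m : ℝ) + 1) ^ 2 / x ^ 2) -
      hoffErrConst q (1 - β) * x ^ (-(5 / 2 : ℝ)) := by
    norm_num at hprod ⊢; linarith
  calc 1.511 * (1 - β) = (1 - β) * 1.511 := mul_comm _ _
    _ < (1 - β) * (x ^ (-(1 - β)) *
        ∑ m ∈ Finset.range 200, (1 / ((m : ℝ) + 1) ^ 2 - 15 * ((m : ℝ) + 1) ^ 2 / x ^ 2) -
        hoffErrConst q (1 - β) * x ^ (-(5 / 2 : ℝ))) := mul_lt_mul_of_pos_left hbr hκ0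
    _ ≤ (χ.LFunction 1).re := hM

open Literature.NumberTheory.LFunctions.DirichletAbel in
/-- **§3, (5) ⇒ (6): the exceptional zero exists.** For a real primitive `χ′` mod `q′ > 10⁶` with
`L(1, χ′) < 1/(7.735 log q′)` ("let `d′` be the discriminant … such that (5) `L(1,χ′) < 1/(7.735 log|d′|)`.
By Lemma 1, `L(s, χ′)` has a real zero, `β′`, and (6) `1 − β′ < 1/(11.657 log|d′|)`", p. 170), there is
a real zero `β′ ∈ (1 − 1/(11.657 log q′), 1)` of `L(s, χ′)` (by `hoffstein_lemma1_part1_sharp` at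
`β = 1 − 0.998/(11.657 log q′)`: `1.511 · 0.998 · 7.735 > 11.657`).
[cite: Hoffstein1980SiegelTatuzawa, §3 (5)–(6) p. 170] -/
theorem exists_realZero_of_lOne_lt (hχ : χ.IsPrimitive) (hquad : χ.IsQuadratic)
    (hq6 : (10 ^ 6 : ℝ) < q) (hL : (χ.LFunction 1).re < 1 / (7.735 * Real.log q)) :
    ∃ β : ℝ, 1 - 1 / (11.657 * Real.log q) < β ∧ β < 1 ∧ χ.LFunction β = 0 := by
  have hlog := log_gt_of_gt_ten6 hq6
  have hlog0 : 0 < Real.log q := by linarith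
  set β : ℝ := 1 - 0.998 / (11.657 * Real.log q) with hβ
  have hβ1 : β < 1 := by
    have : 0 < 0.998 / (11.657 * Real.log q) := by positivity
    rw [hβ]; linarith
  have hκq : 1 - β < 1 / (11.657 * Real.log q) := by
    rw [hβ, sub_sub_cancel]
    exact div_lt_div_of_pos_right (by norm_num) (by positivity)
  have hwin : 1 - 1 / (11.657 * Real.log q) < β := by linarith
  by_contra hne
  push Not at hne
  have hz : ∀ σ : ℝ, β < σ → σ < 1 → χ.LFunction σ ≠ 0 := fun σ h1 h2 h0 ↦
    hne σ (lt_trans hwin h1) h2 h0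
  have h := hoffstein_lemma1_part1_sharp hχ hquad hq6 hβ1 hκq hz
  rw [hβ, sub_sub_cancel] at h
  -- `1.511 · 0.998/(11.657 log q) < L(1) < 1/(7.735 log q)` is impossible
  have h2 := h.trans hL
  rw [mul_div_assoc', div_lt_div_iff₀ (by positivity) (by positivity)] at h2
  nlinarith

end Literature.NumberTheory.LFunctions.Hoffstein1980

namespace Literature.NumberTheory.LFunctions

open Hoffstein1980 in
/-- **Hoffstein's Lemma 1 (Acta Arith. 38 (1980) p. 168) — DISCHARGED.** For `|d| > 10⁶` (`χ` real
primitive mod `q > 10⁶`): no real zero of `L(s,χ)` in `(β, 1)` with `1 − β < 1/(11.657 log q)` gives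
`L(1,χ) > 1.507 (1 − β)`; no real zero in `(0, 1)` gives `L(1,χ) > 1/(1.502 log q)`.
[cite: Hoffstein1980SiegelTatuzawa, §2 Lemma 1 p. 168] -/
theorem hoffstein1980_lemma1_holds : hoffstein1980_lemma1 := by
  intro q _ χ hχ hquad _ hq6
  exact ⟨fun β hβ1 hκ hz ↦ hoffstein_lemma1_part1 hχ hquad hq6 hβ1 hκ hz,
    fun hz ↦ hoffstein_lemma1_part2 hχ hquad hq6 hz⟩

end Literature.NumberTheory.LFunctions

end
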